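import Literature.Probability.RandomPlanarGeometry.HexSAWStripBridgeDecomposition
import Literature.Analysis.Matrix.NonnegMatrixFamilyNeumannBound
import Literature.Probability.RandomPlanarGeometry.HexSAWStripSurfaceWidthOneThreshold
import HarnessLib

/-!
# Renewal structure of the horizontal bridges of the honeycomb strip: irreducible bridges, the split at the first renewal
# index, concatenation, and the first-order bound `D_N(y) ≤ C/(y_T − y)` of the truncated horizontal-bridge series

Topic `Literature/Probability/RandomPlanarGeometry` (continues `HexSAWStripBridgeDecomposition.lean`: `HV.IsHBridge`,
`HV.hBridgesN`, `HV.hBridgeSumN`, `HV.xiAt`; uses `Literature.Analysis.Matrix.nonnegMat_exists_partialSum_pow_apply_le_div`).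
Source of the structure: H. Duminil-Copin, A. Hammond, *Self-avoiding walk is sub-ballistic*, CMP 324 (2013), §2.2 — bridges
`ω₁(0) < ω₁(i) ≤ ω₁(n)`, renewal points ("γ[0,i] and γ[i,n] are bridges"), irreducible bridges, and the unique decomposition of a
bridge into irreducible bridges (Kesten 1963) — here along the column `ξ` of the width-`T` honeycomb strip.  Lane «pcv-sawmu»,
a-p2 g16, `MATHS-NOTE-k1-renewal.md` module [D].

## What is proved (namespace `Literature.Probability.RandomPlanarGeometry.SAW.HV`)

* §1 `IsRenewalIdx l i`, `renIdxs l`, `npieces l = #renIdxs l + 1`, `fIdx l` (first renewal index); the split `fstP l = l[0..f]`,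
  `sndP l = l[f..]`: both are horizontal bridges, the first is irreducible (`renIdxs (fstP l) = ∅`), the second has one piece
  less, the weights `wD l y = x_c^{|l|−1} y^{#top(l.tail)}` multiply, and `l ↦ (fstP l, xstd (sndP l))` is injective.
* §2 `hcat p q` (translate-and-append) and ★ `hcat_spec`: an irreducible standard bridge followed by a standard bridge of
  matching level is a standard bridge of the strip whose first renewal index is `|p| − 1` (so the pair is recovered).
* §3 level classes `HBk T N k a b` (k pieces, levels a → b), sums `Dk`, `Dab`, the `2T × 2T` matrices `Imat T N y` (irreducible
  bridges) and `Dmat`; ★ split inequality `Dk_succ_le_sum` and `Dmat_le_pow : D^{(k)}_N ≤ I_N^k`.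
* §4 ★ concatenation inequality `Imat_mul_Dmat_le : I_N · D^{(k)}_M ≤ D^{(k+1)}_{N+M}`, `pow_Imat_le_Dmat : I_N^k ≤ D^{(k)}_{kN}`,
  `Dab_le_partialSum_stripZL` and ★ `exists_partialSum_pow_Imat_le`: `Σ_{k<n} (I_N(y)^k)_{ab} ≤ B(y)` uniformly in `n, N`
  whenever `x_c ν_T(y) < 1` (all bridges are strip walks; `exists_partialSum_stripZL_le`).
* §5 ★ `reach_Imat_all`: irreducibility of the level graph (explicit one- and two-step irreducible bridges `pair_mem_HBk`,
  `triple_mem_HBk` connect consecutive levels in both directions).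
* §6 the limit matrix `Iinf T y = sup_N Imat T N y` (monotone limits, `tendsto_Imat_pow` by finite sums and products), the top
  step `topStep_mem` (slope `x_c` at the entry `(2T−2, 2T−1)`), and ★★ `exists_partialSum_pow_Iinf_le_div`:
  `Σ_{k<n} (I(y)^k)_{ab} ≤ C/(y_T − y)` on `[1, y_T)` by the tree lemma `nonnegMat_exists_partialSum_pow_apply_le_div`
  (`Literature.Analysis.Matrix.NonnegMatrixFamilyNeumannBound`).
* §7 ★★★ `hBridgeSumN_le_div : ∃ C, ∀ N y, 1 ≤ y → y < y_T → hBridgeSumN T N y ≤ C/(y_T − y)` (`T ≥ 1`) and the lane's (P),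
  UNCONDITIONAL: `stripByLim_mul_sub_le : 2 ≤ T → ∃ A, ∀ y, 1 ≤ y → y < y_T → stripByLim T y * (y_T − y) ≤ A`
  (= `stripByLim_mul_sub_le_of_hBridge_bound` of `HexSAWStripBridgeDecomposition` fed with `hBridgeSumN_le_div`).
  Own result of the lane; the cited sources give the setting (DCH renewal structure, BBDDG strip series, Seneta R-theory).
* §8 width one explicitly (`stripByLim_one_mul_sub_le`, from the tree's exact width-one series) and ★★★ (P) for all `T ≥ 1`:
  `stripByLim_mul_sub_le_of_one_le`.
* §9 ★★★ the LINEAR UPPER LAW in the boxes, for all `T ≥ 1`: `stripGFy_beta_stripYT_le_linear : ∃ C, ∀ L,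
  B_{T,L}(x_c; y_T) ≤ C · (L + 1)` (transfer at `y = y_T L/(L+1)`, degree `≤ |V(S_{T,L})| ≤ 4(T+1)L + 2(T+1)²`).
* §10 ★★★ the CESÀRO COEFFICIENT LAW, for all `T ≥ 1`: `partialSum_stripBcoeff_stripYT_le_linear : ∃ C, ∀ M,
  Σ_{m ≤ M} β_{T,m} y_T^m ≤ C · (M + 1)` (`β_{T,m} = stripBcoeff T m`; transfer at `y = y_T M/(M+1)`, the series inside its radius).
-/

noncomputable section

open Finset Literature.Probability.LatticeModels Literature.Probability.Percolation Literature.Analysis.Matrix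

namespace Literature.Probability.RandomPlanarGeometry.SAW

namespace HV

/-! ### §1 Renewal indices and irreducible horizontal bridges -/

section Renewal

/-- `i` is a **renewal index** of the list `l`: an interior index such that every earlier vertex has column `≤ ξ(l[i])` and every
later vertex has column `> ξ(l[i])` ("γ[0,i] and γ[i,n] are bridges"). [cite: DuminilCopinHammond2013, §2.2 (renewal points R_γ)] -/
def IsRenewalIdx (l : List HV) (i : ℕ) : Prop :=
  0 < i ∧ i + 1 < l.length ∧ (∀ j ∈ range (i + 1), xiAt l j ≤ xiAt l i) ∧ (∀ j ∈ range l.length, i < j → xiAt l i < xiAt l j)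

/-- Renewal indices are decidable (plumbing). [folklore] -/
instance (l : List HV) (i : ℕ) : Decidable (IsRenewalIdx l i) := by unfold IsRenewalIdx; infer_instance

/-- The finite set of renewal indices (plumbing). [folklore] -/
def renIdxs (l : List HV) : Finset ℕ := (range l.length).filter fun i => IsRenewalIdx l i

/-- The number of irreducible pieces of a bridge: one more than the number of its renewal indices.
[cite: DuminilCopinHammond2013, §2.2 (decomposition into irreducible bridges)] -/
def npieces (l : List HV) : ℕ := (renIdxs l).card + 1

/-- The FIRST renewal index (junk `0` if there is none). [cite: DuminilCopinHammond2013, §2.2] -/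
def fIdx (l : List HV) : ℕ := if h : (renIdxs l).Nonempty then (renIdxs l).min' h else 0

/-- The first irreducible piece `l[0 .. f]` (plumbing). [folklore] -/
def fstP (l : List HV) : List HV := l.take (fIdx l + 1)

/-- The remainder `l[f ..]` after the first irreducible piece (plumbing). [folklore] -/
def sndP (l : List HV) : List HV := l.drop (fIdx l)

/-- The weight of a horizontal bridge with its start vertex excluded: `x_c^{|l|−1} y^{#top(l.tail)}` (weights multiply under
concatenation). [cite: DuminilCopinHammond2013, §2.2 (bridges concatenate); BeatonBousquetMelouDeGierDuminilCopinGuttmann2014, §4 (weights x_c^{|γ|} y^{contacts})] -/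
def wD (T : ℕ) (y : ℝ) (l : List HV) : ℝ := hexCriticalFugacity ^ (l.length - 1) * y ^ topCnt T l.tail

variable {l : List HV}

/-- The first renewal index is a renewal index and the smallest one. [cite: DuminilCopinHammond2013, §2.2] -/
theorem fIdx_spec (h : (renIdxs l).Nonempty) :
    IsRenewalIdx l (fIdx l) ∧ ∀ j, IsRenewalIdx l j → fIdx l ≤ j := by
  have hf : fIdx l = (renIdxs l).min' h := by rw [fIdx, dif_pos h]
  have hmem := (renIdxs l).min'_mem h
  rw [← hf, renIdxs, mem_filter] at hmem
  refine ⟨hmem.2, fun j hj => ?_⟩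
  rw [hf]
  exact (renIdxs l).min'_le j (mem_filter.2 ⟨mem_range.2 (by have := hj.2.1; omega), hj⟩)

/-- `l[0..f] ++ (l[f..]).tail = l`. [cite: DuminilCopinHammond2013, §2.2 (bridges of the strip); lane plumbing] -/
theorem fstP_append_tail_sndP (l : List HV) : fstP l ++ (sndP l).tail = l := by
  rw [fstP, sndP, List.tail_drop, List.take_append_drop]

/-- Lengths of the two parts at a renewal split. [cite: DuminilCopinHammond2013, §2.2 (bridges of the strip); lane plumbing] -/
theorem length_fstP_sndP (h : (renIdxs l).Nonempty) :
    (fstP l).length = fIdx l + 1 ∧ (sndP l).length = l.length - fIdx l ∧ 2 ≤ (fstP l).length ∧ 2 ≤ (sndP l).length := by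
  obtain ⟨⟨h0, h1, -, -⟩, -⟩ := fIdx_spec h
  refine ⟨?_, ?_, ?_, ?_⟩ <;> simp only [fstP, sndP, List.length_take, List.length_drop] <;> omega

/-- `xiAt` of a `take`. [cite: DuminilCopinHammond2013, §2.2 (bridges of the strip); lane plumbing] -/
theorem xiAt_take {m j : ℕ} (hj : j < m) : xiAt (l.take m) j = xiAt l j := by
  unfold xiAt
  rw [List.getD_eq_getElem?_getD, List.getD_eq_getElem?_getD, List.getElem?_take_of_lt hj]

/-- `xiAt` of a `drop`. [cite: DuminilCopinHammond2013, §2.2 (bridges of the strip); lane plumbing] -/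
theorem xiAt_drop (m j : ℕ) : xiAt (l.drop m) j = xiAt l (m + j) := by
  unfold xiAt
  rw [List.getD_eq_getElem?_getD, List.getD_eq_getElem?_getD, List.getElem?_drop]

/-- `xiAt` is translation covariant. [cite: DuminilCopinHammond2013, §2.2 (bridges of the strip); lane plumbing] -/
theorem xiAt_map_shift (a : ℤ) (j : ℕ) (hj : j < l.length) : xiAt (l.map (shift a 0)) j = xiAt l j + 2 * a := by
  rw [xiAt_eq_xi_getElem (by simpa using hj), xiAt_eq_xi_getElem hj, List.getElem_map, xi_shift_zero]

/-- Renewal indices are translation invariant. [cite: DuminilCopinHammond2013, §2.2] -/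
theorem isRenewalIdx_map_shift (a : ℤ) (i : ℕ) : IsRenewalIdx (l.map (shift a 0)) i ↔ IsRenewalIdx l i := by
  unfold IsRenewalIdx
  simp only [List.length_map, mem_range]
  constructor
  · rintro ⟨h0, h1, h2, h3⟩
    refine ⟨h0, h1, fun j hj => ?_, fun j hj hij => ?_⟩
    · have := h2 j hj; rw [xiAt_map_shift a j (by omega), xiAt_map_shift a i (by omega)] at this; linarith
    · have := h3 j hj hij; rw [xiAt_map_shift a j hj, xiAt_map_shift a i (by omega)] at this; linarith
  · rintro ⟨h0, h1, h2, h3⟩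
    refine ⟨h0, h1, fun j hj => ?_, fun j hj hij => ?_⟩
    · rw [xiAt_map_shift a j (by omega), xiAt_map_shift a i (by omega)]; linarith [h2 j hj]
    · rw [xiAt_map_shift a j hj, xiAt_map_shift a i (by omega)]; linarith [h3 j hj hij]

/-- The renewal indices are translation invariant. [cite: DuminilCopinHammond2013, §2.2] -/
theorem renIdxs_map_shift (a : ℤ) (l : List HV) : renIdxs (l.map (shift a 0)) = renIdxs l := by
  ext i
  simp only [renIdxs, mem_filter, mem_range, List.length_map, isRenewalIdx_map_shift]

/-- `npieces` is translation invariant, in particular under `xstd`. [cite: DuminilCopinHammond2013, §2.2] -/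
theorem npieces_xstd (l : List HV) : npieces (xstd l) = npieces l := by
  rw [npieces, npieces, xstd, renIdxs_map_shift]

/-- ★ **The renewal indices of the remainder**: `i` is a renewal index of `l[f..]` iff `f + i` is a renewal index of `l` (for a
horizontal bridge `l` with first renewal index `f`). [cite: DuminilCopinHammond2013, §2.2 (R_γ and the decomposition)] -/
theorem isRenewalIdx_sndP_iff (h : (renIdxs l).Nonempty) (i : ℕ) :
    IsRenewalIdx (sndP l) i ↔ 0 < i ∧ IsRenewalIdx l (fIdx l + i) := by
  obtain ⟨⟨hf0, hf1, hfle, hflt⟩, -⟩ := fIdx_spec h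
  have hlen2 : (sndP l).length = l.length - fIdx l := (length_fstP_sndP h).2.1
  unfold IsRenewalIdx
  rw [hlen2]
  simp only [mem_range, sndP, xiAt_drop]
  constructor
  · rintro ⟨h0, h1, h2, h3⟩
    refine ⟨h0, by omega, by omega, fun j hj => ?_, fun j hj hij => ?_⟩
    · by_cases hjf : j ≤ fIdx l
      · -- earlier vertices are `≤ ξ(l[f]) < ξ(l[f+i])`
        have a1 := hfle j (mem_range.2 (by omega))
        have a2 := hflt (fIdx l + i) (mem_range.2 (by omega)) (by omega)
        linarith
      · have := h2 (j - fIdx l) (by omega)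
        rwa [show fIdx l + (j - fIdx l) = j by omega] at this
    · have := h3 (j - fIdx l) (by omega) (by omega)
      rwa [show fIdx l + (j - fIdx l) = j by omega] at this
  · rintro ⟨hi, h0, h1, h2, h3⟩
    refine ⟨hi, by omega, fun j hj => h2 (fIdx l + j) (by omega), fun j hj hij =>
      h3 (fIdx l + j) (by omega) (by omega)⟩

/-- The renewal indices of the remainder are those of `l` after the first one, shifted. [cite: DuminilCopinHammond2013, §2.2] -/
theorem renIdxs_sndP_map (h : (renIdxs l).Nonempty) :
    (renIdxs (sndP l)).map (addLeftEmbedding (fIdx l)) = (renIdxs l).erase (fIdx l) := by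
  obtain ⟨hf, hmin⟩ := fIdx_spec h
  have hlen2 : (sndP l).length = l.length - fIdx l := (length_fstP_sndP h).2.1
  ext j
  simp only [mem_map, mem_erase, renIdxs, mem_filter, mem_range, addLeftEmbedding_apply, hlen2]
  constructor
  · rintro ⟨i, ⟨hi, hri⟩, rfl⟩
    have := (isRenewalIdx_sndP_iff h i).1 hri
    exact ⟨by omega, by have := this.2.2.1; omega, this.2⟩
  · rintro ⟨hne, hj, hrj⟩
    have hle := hmin j hrj
    refine ⟨j - fIdx l, ⟨by have := hrj.2.1; omega, ?_⟩, by omega⟩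
    rw [isRenewalIdx_sndP_iff h, show fIdx l + (j - fIdx l) = j by omega]
    exact ⟨by omega, hrj⟩

/-- ★ The remainder has one irreducible piece less. [cite: DuminilCopinHammond2013, §2.2 (decomposition into irreducible bridges)] -/
theorem npieces_sndP (h : (renIdxs l).Nonempty) : npieces (sndP l) + 1 = npieces l := by
  have hmem : fIdx l ∈ renIdxs l := by rw [fIdx, dif_pos h]; exact (renIdxs l).min'_mem h
  rw [npieces, npieces, ← Finset.card_map (addLeftEmbedding (fIdx l)), renIdxs_sndP_map h, Finset.card_erase_of_mem hmem]
  have : 0 < (renIdxs l).card := Finset.card_pos.2 h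
  omega

/-- ★ The first piece is irreducible (no renewal index). [cite: DuminilCopinHammond2013, §2.2 (the first irreducible bridge)] -/
theorem renIdxs_fstP (h : (renIdxs l).Nonempty) : renIdxs (fstP l) = ∅ := by
  obtain ⟨⟨hf0, hf1, hfle, hflt⟩, hmin⟩ := fIdx_spec h
  have hlen1 : (fstP l).length = fIdx l + 1 := (length_fstP_sndP h).1
  rw [Finset.eq_empty_iff_forall_notMem]
  intro i hi
  rw [renIdxs, mem_filter, mem_range, hlen1] at hi
  obtain ⟨hil, h0, h1, h2, h3⟩ := hi
  rw [hlen1] at h1 h3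
  -- `i < f` would be a renewal index of `l` smaller than `f`
  have hi' : IsRenewalIdx l i := by
    refine ⟨h0, by omega, fun j hj => ?_, fun j hj hij => ?_⟩
    · have := h2 j hj
      rw [mem_range] at hj
      rwa [fstP, xiAt_take (by omega), xiAt_take (by omega)] at this
    · rw [mem_range] at hj
      by_cases hjf : j ≤ fIdx l
      · have := h3 j (mem_range.2 (by omega)) hij
        rwa [fstP, xiAt_take (by omega), xiAt_take (by omega)] at this
      · -- later vertices: `ξ(l[i]) ≤ ξ(l[f]) < ξ(l[j])`
        have a1 : xiAt l i ≤ xiAt l (fIdx l) := hfle i (mem_range.2 (by omega))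
        have a2 := hflt j (mem_range.2 hj) (by omega)
        linarith
  have := hmin i hi'
  omega

/-- The head, last vertex and tail membership of the two parts. [cite: DuminilCopinHammond2013, §2.2] -/
theorem fstP_sndP_ends (h : (renIdxs l).Nonempty) :
    (∀ hne, (fstP l).head hne = l.head (by rintro rfl; simp [renIdxs] at h)) ∧
    (∀ hne, (fstP l).getLast hne = l[fIdx l]'(by have := (fIdx_spec h).1.2.1; omega)) ∧
    (∀ hne, (sndP l).head hne = l[fIdx l]'(by have := (fIdx_spec h).1.2.1; omega)) ∧
    (∀ hne, (sndP l).getLast hne = l.getLast (by rintro rfl; simp [renIdxs] at h)) := by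
  obtain ⟨⟨hf0, hf1, -, -⟩, -⟩ := fIdx_spec h
  refine ⟨fun hne => ?_, fun hne => ?_, fun hne => ?_, fun hne => ?_⟩
  · change (l.take (fIdx l + 1)).head hne = _
    rw [List.head_take]
  · exact getLast_take_succ (by omega) hne
  · change (l.drop (fIdx l)).head hne = _
    rw [List.head_drop]
  · change (l.drop (fIdx l)).getLast hne = _
    rw [List.getLast_drop]

/-- The two parts are nonempty (they have at least two vertices). [cite: DuminilCopinHammond2013, §2.2 (bridges of the strip); lane plumbing] -/
theorem fstP_sndP_ne_nil (h : (renIdxs l).Nonempty) : fstP l ≠ [] ∧ sndP l ≠ [] := by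
  have hlen := length_fstP_sndP h
  exact ⟨List.ne_nil_of_length_pos (by omega), List.ne_nil_of_length_pos (by omega)⟩

/-- ★ Both parts of the split of a horizontal bridge at its first renewal index are horizontal bridges.
[cite: DuminilCopinHammond2013, §2.2 ("γ[0,i] and γ[i,n] are bridges")] -/
theorem isHBridge_fstP_sndP (hB : IsHBridge l) (h : (renIdxs l).Nonempty) : IsHBridge (fstP l) ∧ IsHBridge (sndP l) := by
  obtain ⟨⟨hf0, hf1, hfle, hflt⟩, -⟩ := fIdx_spec h
  obtain ⟨hne, hb⟩ := hB
  obtain ⟨e1, e2, e3, e4⟩ := fstP_sndP_ends h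
  have hlen := length_fstP_sndP h
  obtain ⟨hne1, hne2⟩ := fstP_sndP_ne_nil h
  constructor
  · refine ⟨hne1, fun v hv => ?_⟩
    rw [e1, e2, ← xiAt_eq_xi_getElem (by omega)]
    rw [fstP, ← List.drop_one, List.drop_take, List.mem_take_iff_getElem] at hv
    obtain ⟨j, hj, rfl⟩ := hv
    simp only [List.length_drop] at hj
    rw [List.getElem_drop, ← xiAt_eq_xi_getElem (by omega)]
    have h1 : 1 + j < fIdx l + 1 := by omega
    refine ⟨?_, hfle (1 + j) (mem_range.2 h1)⟩
    -- `ξ(head) < ξ(l[1+j])` from `l` being a bridge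
    have := (hb (l[1 + j]'(by omega)) (by
      rw [← List.drop_one, List.mem_drop_iff_getElem]; exact ⟨j, by omega, rfl⟩)).1
    rwa [← xiAt_eq_xi_getElem (by omega)] at this
  · refine ⟨hne2, fun v hv => ?_⟩
    rw [e3, e4, ← xiAt_eq_xi_getElem (by omega)]
    rw [sndP, List.tail_drop, List.mem_drop_iff_getElem] at hv
    obtain ⟨j, hj, rfl⟩ := hv
    refine ⟨?_, (hb _ (by rw [← List.drop_one, List.mem_drop_iff_getElem]; exact ⟨fIdx l + j, by omega, by congr 1; omega⟩)).2⟩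
    rw [← xiAt_eq_xi_getElem (by omega)]
    exact hflt (fIdx l + 1 + j) (mem_range.2 (by omega)) (by omega)

/-- ★ The weights multiply at a renewal split: `wD(l) = wD(l[0..f]) · wD(l[f..])`.
[cite: DuminilCopinHammond2013, §2.2; BeatonBousquetMelouDeGierDuminilCopinGuttmann2014, §4] -/
theorem wD_eq_mul_fstP_sndP (T : ℕ) (y : ℝ) (h : (renIdxs l).Nonempty) :
    wD T y l = wD T y (fstP l) * wD T y (sndP l) := by
  obtain ⟨⟨hf0, hf1, -, -⟩, -⟩ := fIdx_spec h
  have hlen := length_fstP_sndP h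
  obtain ⟨hne1, -⟩ := fstP_sndP_ne_nil h
  have htail : l.tail = (fstP l).tail ++ (sndP l).tail := by
    conv_lhs => rw [← fstP_append_tail_sndP l]
    rw [List.tail_append_of_ne_nil hne1]
  rw [wD, wD, wD, htail, topCnt_append, pow_add]
  have : l.length - 1 = (fstP l).length - 1 + ((sndP l).length - 1) := by omega
  rw [this, pow_add]; ring

/-- ★ The split is injective on bridges with a renewal index: `l` is recovered from `(l[0..f], xstd l[f..])`.
[cite: DuminilCopinHammond2013, §2.2 (unique decomposition)] -/
theorem split_injOn : Set.InjOn (fun l : List HV => (fstP l, xstd (sndP l))) {l | (renIdxs l).Nonempty} := by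
  intro l hl l' hl' heq
  simp only [Prod.mk.injEq] at heq
  obtain ⟨h1, h2⟩ := heq
  have hlen := length_fstP_sndP hl
  have hlen' := length_fstP_sndP hl'
  have hf : fIdx l = fIdx l' := by
    have := congrArg List.length h1
    rw [hlen.1, hlen'.1] at this; omega
  obtain ⟨-, e2, e3, -⟩ := fstP_sndP_ends hl
  obtain ⟨-, e2', e3', -⟩ := fstP_sndP_ends hl'
  obtain ⟨hne1, hne2⟩ := fstP_sndP_ne_nil hl
  obtain ⟨hne1', hne2'⟩ := fstP_sndP_ne_nil hl'
  have hhead : (sndP l).head? = (sndP l').head? := by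
    rw [List.head?_eq_some_head hne2, List.head?_eq_some_head hne2', e3, e3', ← e2 hne1, ← e2' hne1']
    congr 1
    simp only [h1]
  have hs : sndP l = sndP l' := xstd_inj_of_head h2 hhead
  rw [← fstP_append_tail_sndP l, ← fstP_append_tail_sndP l', h1, hs]

end Renewal


/-! ### §2 Concatenation of an irreducible bridge with a bridge of matching level -/

section Concat

/-- Two vertices on the same level have the same `(x₁, b)` part. [cite: DuminilCopinSmirnov2012, §3 (levels)] -/
theorem snd_eq_of_lev_eq {u v : HV} (h : lev u = lev v) : u.2 = v.2 := by
  obtain ⟨a, b, c⟩ := u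
  obtain ⟨a', b', c'⟩ := v
  cases c <;> cases c' <;> simp [bit] at h ⊢ <;> omega

/-- **Concatenation** of two standard-head lists: translate the second so that its head lands on the last vertex of the first and
append its tail. [cite: DuminilCopinHammond2013, §2.2 (concatenation of bridges)] -/
def hcat (p q : List HV) : List HV := p ++ q.tail.map (shift (p.getLast?.getD hvOrigin).1 0)

variable {T : ℕ} {p q : List HV}

/-- The translate of the standard head of `q` is the last vertex of `p` when their levels agree. [cite: DuminilCopinHammond2013, §2.2] -/
theorem shift_head_eq_getLast (hp : p ≠ []) (hq : q ≠ []) (hq0 : (q.head hq).1 = 0)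
    (hlev : lev (p.getLast hp) = lev (q.head hq)) :
    shift (p.getLast?.getD hvOrigin).1 0 (q.head hq) = p.getLast hp := by
  rw [List.getLast?_eq_some_getLast hp, Option.getD_some]
  have h2 := snd_eq_of_lev_eq hlev
  revert h2 hq0
  generalize p.getLast hp = u
  generalize q.head hq = v
  intro hq0 h2
  obtain ⟨a, b, c⟩ := u
  obtain ⟨a', b', c'⟩ := v
  simp only at h2 hq0
  obtain ⟨rfl, rfl⟩ := Prod.mk.inj h2
  subst hq0
  simp

set_option maxHeartbeats 400000 in
/-- ★ **The concatenation of an irreducible standard bridge `p` (length ≥ 2) and a standard bridge `q` (length ≥ 2) of matching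
level is a standard horizontal bridge of the strip whose FIRST renewal index is `|p| − 1`**; hence its first piece is `p`, its
remainder is the translate of `q`, it has one piece more than `q`, and its weight is the product.
[cite: DuminilCopinHammond2013, §2.2 (concatenation of bridges; renewal points of a concatenation)] -/
theorem hcat_spec (hpc : p.IsChain hvGraph.Adj) (hpn : p.Nodup) (hpin : InLev T p) (hpB : IsHBridge p) (hpirr : renIdxs p = ∅)
    (hp2 : 2 ≤ p.length) (hqc : q.IsChain hvGraph.Adj) (hqn : q.Nodup) (hqin : InLev T q) (hqB : IsHBridge q)
    (hq2 : 2 ≤ q.length) (hq0 : ∀ hq : q ≠ [], (q.head hq).1 = 0)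
    (hlev : ∀ (hp : p ≠ []) (hq : q ≠ []), lev (p.getLast hp) = lev (q.head hq)) :
    (hcat p q).IsChain hvGraph.Adj ∧ (hcat p q).Nodup ∧ InLev T (hcat p q) ∧ IsHBridge (hcat p q) ∧
      (hcat p q).length = p.length + q.length - 1 ∧ (hcat p q).head? = p.head? ∧
      (renIdxs (hcat p q)).Nonempty ∧ fIdx (hcat p q) = p.length - 1 ∧ fstP (hcat p q) = p ∧
      sndP (hcat p q) = q.map (shift (p.getLast?.getD hvOrigin).1 0) := by
  have hp : p ≠ [] := List.ne_nil_of_length_pos (by omega)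
  have hq : q ≠ [] := List.ne_nil_of_length_pos (by omega)
  obtain ⟨hpne, hpb⟩ := hpB
  obtain ⟨hqne, hqb⟩ := hqB
  have hu0' := shift_head_eq_getLast hp hq (hq0 hq) (hlev hp hq)
  -- destructure `q = u0 :: u1 :: urest`
  obtain ⟨u0, u1, urest, rfl⟩ : ∃ u0 u1 urest, q = u0 :: u1 :: urest := by
    match q, hq2 with
    | u0 :: u1 :: urest, _ => exact ⟨u0, u1, urest, rfl⟩
  set a := (p.getLast?.getD hvOrigin).1 with ha
  have hu0 : shift a 0 u0 = p.getLast hp := by simpa using hu0'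
  have hcat_eq : hcat p (u0 :: u1 :: urest) = p ++ (shift a 0 u1 :: urest.map (shift a 0)) := by
    rw [hcat, ← ha]; rfl
  simp only [List.tail_cons, List.head_cons, List.getLast_cons_cons] at hqb
  -- columns: `p` lies weakly left of its last vertex, the appended part strictly right of it
  have hxp : ∀ v ∈ p, xi v ≤ xi (p.getLast hp) := by
    intro v hv
    have hv' : v ∈ p.head hp :: p.tail := by rw [List.cons_head_tail]; exact hv
    rcases List.mem_cons.1 hv' with rfl | hv''
    · obtain ⟨w, hw⟩ : ∃ w, w ∈ p.tail := by
        match p, hp2 with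
        | _ :: w :: _, _ => exact ⟨w, by simp⟩
      have := hpb w hw; linarith [this.1, this.2]
    · exact (hpb v hv'').2
  set uL := (u1 :: urest).getLast (List.cons_ne_nil _ _) with huL
  have hxq : ∀ w ∈ shift a 0 u1 :: urest.map (shift a 0), xi (p.getLast hp) < xi w ∧ xi w ≤ xi (shift a 0 uL) := by
    intro w hw
    have hw' : w ∈ (u1 :: urest).map (shift a 0) := by simpa using hw
    rw [List.mem_map] at hw'
    obtain ⟨w0, hw0, rfl⟩ := hw'
    rw [← hu0, xi_shift_zero, xi_shift_zero, xi_shift_zero]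
    have := hqb w0 hw0
    constructor <;> linarith [this.1, this.2]
  have hadj01 : hvGraph.Adj (p.getLast hp) (shift a 0 u1) := by
    rw [← hu0]
    exact (shift a 0).map_rel_iff.2 (List.isChain_cons_cons.1 hqc).1
  have hrestc : (shift a 0 u1 :: urest.map (shift a 0)).IsChain hvGraph.Adj := by
    have h2 : ((u1 :: urest).map (shift a 0)).IsChain hvGraph.Adj := by
      rw [List.isChain_map]; exact (List.isChain_cons_cons.1 hqc).2.imp fun x y h => (shift _ _).map_rel_iff.2 h
    simpa using h2
  -- (1) chain
  have hc : (hcat p (u0 :: u1 :: urest)).IsChain hvGraph.Adj := by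
    rw [hcat_eq]
    refine List.IsChain.append hpc hrestc fun x hx y hy => ?_
    rw [List.getLast?_eq_some_getLast hp, Option.mem_def, Option.some.injEq] at hx
    simp only [List.head?_cons, Option.mem_def, Option.some.injEq] at hy
    subst hx; subst hy
    exact hadj01
  -- (2) nodup
  have hnd : (hcat p (u0 :: u1 :: urest)).Nodup := by
    rw [hcat_eq, List.nodup_append]
    have hqn' : ((u0 :: u1 :: urest).map (shift a 0)).Nodup := hqn.map (shift a 0).injective
    simp only [List.map_cons, List.nodup_cons] at hqn'
    refine ⟨hpn, List.nodup_cons.2 ⟨hqn'.2.1, hqn'.2.2⟩, fun v hv w hw hvw => ?_⟩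
    subst hvw
    have h1 := hxp v hv; have h2 := (hxq v hw).1; linarith
  -- (3) levels
  have hin : InLev T (hcat p (u0 :: u1 :: urest)) := by
    intro v hv
    rw [hcat_eq, List.mem_append] at hv
    rcases hv with hv | hv
    · exact hpin v hv
    · have hv' : v ∈ (u1 :: urest).map (shift a 0) := by simpa using hv
      rw [List.mem_map] at hv'
      obtain ⟨w, hw, rfl⟩ := hv'
      rw [lev_shift_zero]; exact hqin w (by simp at hw ⊢; tauto)
  -- lengths, head, last
  have hne : hcat p (u0 :: u1 :: urest) ≠ [] := by rw [hcat_eq]; simp [hp]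
  have hlen : (hcat p (u0 :: u1 :: urest)).length = p.length + (u0 :: u1 :: urest).length - 1 := by
    rw [hcat_eq, List.length_append]; simp only [List.length_cons, List.length_map]; omega
  have hheadc : (hcat p (u0 :: u1 :: urest)).head hne = p.head hp := by
    simp only [hcat_eq]; rw [List.head_append_of_ne_nil]
  have hlastc : (hcat p (u0 :: u1 :: urest)).getLast hne = shift a 0 uL := by
    simp only [hcat_eq]
    rw [List.getLast_append_of_ne_nil _ (List.cons_ne_nil _ _)]
    have : (shift a 0 u1 :: urest.map (shift a 0)) = ((u1 :: urest).map (shift a 0)) := rfl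
    simp only [this, List.getLast_map, huL]
  -- (4) bridge
  have hB : IsHBridge (hcat p (u0 :: u1 :: urest)) := by
    refine ⟨hne, fun v hv => ?_⟩
    rw [hheadc, hlastc]
    rw [hcat_eq, List.tail_append_of_ne_nil hp, List.mem_append] at hv
    have hpl : xi (p.getLast hp) ≤ xi (shift a 0 uL) := by
      have := hxq (shift a 0 u1) (by simp); linarith [this.1, this.2]
    rcases hv with hv | hv
    · have := hpb v hv
      exact ⟨this.1, (hxp v (List.tail_subset _ hv)).trans hpl⟩
    · have h1 := hxq v hv
      have h2 : xi (p.head hp) ≤ xi (p.getLast hp) := hxp _ (List.head_mem hp)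
      exact ⟨by linarith [h1.1], h1.2⟩
  -- (5) the first renewal index is `|p| − 1`
  have hxiAt_p : ∀ j, j < p.length → xiAt (hcat p (u0 :: u1 :: urest)) j = xiAt p j := by
    intro j hj
    rw [xiAt_eq_xi_getElem (by rw [hlen]; simp; omega), xiAt_eq_xi_getElem hj]
    simp only [hcat_eq, List.getElem_append_left hj]
  have hren : IsRenewalIdx (hcat p (u0 :: u1 :: urest)) (p.length - 1) := by
    refine ⟨by omega, by rw [hlen]; simp; omega, fun j hj => ?_, fun j hj hij => ?_⟩
    · rw [mem_range] at hj
      rw [hxiAt_p j (by omega), hxiAt_p (p.length - 1) (by omega), xiAt_eq_xi_getElem (by omega),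
        xiAt_eq_xi_getElem (by omega), ← List.getLast_eq_getElem hp]
      exact hxp _ (List.getElem_mem _)
    · rw [mem_range, hlen] at hj
      simp only [List.length_cons] at hj
      rw [hxiAt_p (p.length - 1) (by omega), xiAt_eq_xi_getElem (by omega), ← List.getLast_eq_getElem hp,
        xiAt_eq_xi_getElem (by rw [hlen]; simp; omega)]
      have hmem : (hcat p (u0 :: u1 :: urest))[j]'(by rw [hlen]; simp; omega) ∈ shift a 0 u1 :: urest.map (shift a 0) := by
        simp only [hcat_eq]
        rw [List.getElem_append_right (by omega)]
        exact List.getElem_mem _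
      exact (hxq _ hmem).1
  have hnone : ∀ i, IsRenewalIdx (hcat p (u0 :: u1 :: urest)) i → p.length - 1 ≤ i := by
    intro i hi
    by_contra hlt
    push Not at hlt
    have : i ∈ renIdxs p := by
      rw [renIdxs, mem_filter, mem_range]
      obtain ⟨h0, h1, h2, h3⟩ := hi
      refine ⟨by omega, h0, by omega, fun j hj => ?_, fun j hj hij => ?_⟩
      · rw [mem_range] at hj
        have := h2 j (mem_range.2 hj)
        rwa [hxiAt_p j (by omega), hxiAt_p i (by omega)] at this
      · rw [mem_range] at hj
        have := h3 j (mem_range.2 (by rw [hlen]; simp; omega)) hij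
        rwa [hxiAt_p j hj, hxiAt_p i (by omega)] at this
    rw [hpirr] at this
    simp at this
  have hrne : (renIdxs (hcat p (u0 :: u1 :: urest))).Nonempty :=
    ⟨p.length - 1, mem_filter.2 ⟨mem_range.2 (by rw [hlen]; simp; omega), hren⟩⟩
  have hf : fIdx (hcat p (u0 :: u1 :: urest)) = p.length - 1 := by
    have h1 := (fIdx_spec hrne).2 _ hren
    have h2 := hnone _ (fIdx_spec hrne).1
    omega
  have hfst : fstP (hcat p (u0 :: u1 :: urest)) = p := by
    rw [fstP, hf, show p.length - 1 + 1 = p.length by omega, hcat_eq, List.take_left]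
  have hsnd : sndP (hcat p (u0 :: u1 :: urest)) = (u0 :: u1 :: urest).map (shift a 0) := by
    rw [sndP, hf, hcat_eq, List.drop_append_of_le_length (by omega), List.drop_length_sub_one hp, List.singleton_append]
    simp [hu0]
  refine ⟨hc, hnd, hin, hB, hlen, ?_, hrne, hf, hfst, hsnd⟩
  rw [List.head?_eq_some_head hne, hheadc, List.head?_eq_some_head hp]

end Concat


/-! ### §3 Level-indexed sums and the two matrix inequalities -/

section Sums

variable {T : ℕ}

/-- Level of the head (junk `0` for `[]`) (plumbing). [folklore] -/
def hdLev (l : List HV) : ℤ := lev (l.head?.getD hvOrigin)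

/-- Level of the last vertex (junk `0` for `[]`) (plumbing). [folklore] -/
def ltLev (l : List HV) : ℤ := lev (l.getLast?.getD hvOrigin)

/-- Standard horizontal bridges of the strip with at least two vertices, `k` irreducible pieces, from level `a` to level `b`
(plumbing). [folklore] -/
def HBk (T N k : ℕ) (a b : ℤ) : Finset (List HV) :=
  (hBridgesN T N).filter fun l => 2 ≤ l.length ∧ npieces l = k ∧ hdLev l = a ∧ ltLev l = b

/-- Standard horizontal bridges with at least two vertices from level `a` to level `b` (plumbing). [folklore] -/
def HBab (T N : ℕ) (a b : ℤ) : Finset (List HV) :=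
  (hBridgesN T N).filter fun l => 2 ≤ l.length ∧ hdLev l = a ∧ ltLev l = b

/-- `D^{(k)}_N(a,b)(y)`: weight of the `k`-piece bridges (plumbing). [folklore] -/
def Dk (T N k : ℕ) (a b : ℤ) (y : ℝ) : ℝ := ∑ l ∈ HBk T N k a b, wD T y l

/-- `D_N(a,b)(y)`: weight of all bridges from level `a` to level `b` (plumbing). [folklore] -/
def Dab (T N : ℕ) (a b : ℤ) (y : ℝ) : ℝ := ∑ l ∈ HBab T N a b, wD T y l

/-- ★ **The matrix of irreducible horizontal bridges** `I_N(y)_{ab} = Σ_{irreducible a → b, ≤ N+1 vertices} x_c^{|h|−1} y^{#top(h.tail)}`,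
indexed by the `2T` levels. [cite: DuminilCopinHammond2013, §2.2 (irreducible bridges); lane (MATHS-NOTE-k1-renewal [D])] -/
def Imat (T N : ℕ) (y : ℝ) : Matrix (Fin (2 * T)) (Fin (2 * T)) ℝ := fun a b => Dk T N 1 (a : ℕ) (b : ℕ) y

/-- The matrix of `k`-piece bridges (plumbing). [folklore] -/
def Dmat (T N k : ℕ) (y : ℝ) : Matrix (Fin (2 * T)) (Fin (2 * T)) ℝ := fun a b => Dk T N k (a : ℕ) (b : ℕ) y

variable {N M k : ℕ} {y : ℝ} {l : List HV}

/-- `wD ≥ 0` for `y ≥ 0`. [cite: DuminilCopinHammond2013, §2.2 (bridges of the strip); lane plumbing] -/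
theorem wD_nonneg (T : ℕ) (hy : 0 ≤ y) (l : List HV) : 0 ≤ wD T y l :=
  mul_nonneg (pow_nonneg hexCriticalFugacity_pos_lt_one.1.le _) (pow_nonneg hy _)

/-- Unpacking membership in `hBridgesN`. [cite: DuminilCopinHammond2013, §2.2] -/
theorem mem_hBridgesN_iff {l : List HV} : l ∈ hBridgesN T N ↔
    l.IsChain hvGraph.Adj ∧ l.Nodup ∧ l.length ≤ N + 1 ∧ (∃ v, l.head? = some v ∧ v.1 = 0) ∧ InLev T l ∧ IsHBridge l := by
  rw [hBridgesN, mem_filter, mem_biUnion]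
  constructor
  · rintro ⟨⟨n, hn, hsc⟩, hB⟩
    obtain ⟨hc, hnd, hlen, hh, hin⟩ := mem_stripChains_iff.1 hsc
    rw [mem_range] at hn
    exact ⟨hc, hnd, by omega, hh, hin, hB⟩
  · rintro ⟨hc, hnd, hlen, hh, hin, hB⟩
    obtain ⟨hne, hb⟩ := hB
    refine ⟨⟨l.length - 1, mem_range.2 (by omega), mem_stripChains_iff.2 ⟨hc, hnd, ?_, hh, hin⟩⟩, ⟨hne, hb⟩⟩
    have := List.length_pos_of_ne_nil hne; omega

/-- Head and last levels of a list of the strip lie in `[0, 2T−1]`. [cite: DuminilCopinSmirnov2012, §3] -/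
theorem hdLev_ltLev_bounds (hin : InLev T l) (hne : l ≠ []) :
    0 ≤ hdLev l ∧ hdLev l ≤ 2 * (T : ℤ) - 1 ∧ 0 ≤ ltLev l ∧ ltLev l ≤ 2 * (T : ℤ) - 1 := by
  have h1 := hin _ (List.head_mem hne)
  have h2 := hin _ (List.getLast_mem hne)
  rw [hdLev, List.head?_eq_some_head hne, Option.getD_some, ltLev, List.getLast?_eq_some_getLast hne, Option.getD_some]
  exact ⟨h1.1, h1.2, h2.1, h2.2⟩

/-- ★ **Split inequality**: a `(k+1)`-piece bridge from `a` to `b` is an irreducible bridge from `a` to some level `c` followed by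
a `k`-piece bridge from `c` to `b` (injectively, weights multiply):
`D^{(k+1)}_N(a,b) ≤ Σ_c I_N(a,c) D^{(k)}_N(c,b)`. [cite: DuminilCopinHammond2013, §2.2 (decomposition at the first renewal point)] -/
theorem Dk_succ_le_sum (hy : 0 ≤ y) (hk : 1 ≤ k) (a b : Fin (2 * T)) :
    Dk T N (k + 1) (a : ℕ) (b : ℕ) y ≤ ∑ c : Fin (2 * T), Imat T N y a c * Dmat T N k y c b := by
  classical
  -- the split map and its target
  set S := HBk T N (k + 1) (a : ℕ) (b : ℕ) with hS
  set tgt : Finset (List HV × List HV) :=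
    (Finset.univ : Finset (Fin (2 * T))).biUnion fun c => HBk T N 1 (a : ℕ) (c : ℕ) ×ˢ HBk T N k (c : ℕ) (b : ℕ) with htgt
  have hmemS : ∀ l ∈ S, l.IsChain hvGraph.Adj ∧ l.Nodup ∧ l.length ≤ N + 1 ∧ (∃ v, l.head? = some v ∧ v.1 = 0) ∧ InLev T l ∧
      IsHBridge l ∧ 2 ≤ l.length ∧ npieces l = k + 1 ∧ hdLev l = a ∧ ltLev l = b ∧ (renIdxs l).Nonempty := by
    intro l hl
    rw [hS, HBk, mem_filter, mem_hBridgesN_iff] at hl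
    obtain ⟨⟨hc, hnd, hlen, hh, hin, hB⟩, h2, hnp, ha, hb⟩ := hl
    refine ⟨hc, hnd, hlen, hh, hin, hB, h2, hnp, ha, hb, ?_⟩
    rw [npieces] at hnp
    exact Finset.card_pos.1 (by omega)
  -- image in the target
  have himg : ∀ l ∈ S, (fstP l, xstd (sndP l)) ∈ tgt := by
    intro l hl
    obtain ⟨hc, hnd, hlen, ⟨v, hv, hv0⟩, hin, hB, h2, hnp, ha, hb, hren⟩ := hmemS l hl
    have hlens := length_fstP_sndP hren
    obtain ⟨hB1, hB2⟩ := isHBridge_fstP_sndP hB hren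
    obtain ⟨e1, e2, e3, e4⟩ := fstP_sndP_ends hren
    obtain ⟨hne1, hne2⟩ := fstP_sndP_ne_nil hren
    have hl : l ≠ [] := by rintro rfl; simp at h2
    -- the junction level
    have hcl := hin _ (List.getElem_mem (fIdx_spec hren).1.2.1.le)
    set cz : ℤ := lev (l[fIdx l]'(by have := (fIdx_spec hren).1.2.1; omega)) with hcz
    have hcz0 : 0 ≤ cz ∧ cz ≤ 2 * (T : ℤ) - 1 := hin _ (List.getElem_mem _)
    let c : Fin (2 * T) := ⟨cz.toNat, by omega⟩
    have hcc : ((c : ℕ) : ℤ) = cz := by simp [c]; omega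
    rw [htgt, mem_biUnion]
    refine ⟨c, mem_univ _, mem_product.2 ⟨?_, ?_⟩⟩
    · show fstP l ∈ HBk T N 1 _ _
      rw [HBk, mem_filter, mem_hBridgesN_iff]
      refine ⟨⟨hc.take _, hnd.sublist (List.take_sublist _ _), by omega, ⟨v, ?_, hv0⟩,
        fun w hw => hin w ((List.take_sublist _ _).subset hw), hB1⟩, by omega, by rw [npieces, renIdxs_fstP hren]; rfl, ?_, ?_⟩
      · rw [fstP, List.head?_take, if_neg (by omega), hv]
      · rw [hdLev, fstP, List.head?_take, if_neg (by omega)]; rw [hdLev] at ha; exact ha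
      · rw [ltLev, List.getLast?_eq_some_getLast hne1, Option.getD_some, e2, hcc]
    · show xstd (sndP l) ∈ HBk T N k _ _
      rw [HBk, mem_filter, mem_hBridgesN_iff]
      have hv2 : (sndP l).head? = some (l[fIdx l]'(by have := (fIdx_spec hren).1.2.1; omega)) := by
        rw [List.head?_eq_some_head hne2, e3]
      refine ⟨⟨isChain_xstd (hc.drop _), nodup_xstd (hnd.sublist (List.drop_sublist _ _)), by rw [length_xstd]; omega,
        ⟨_, head?_xstd hv2, rfl⟩, inLev_xstd fun w hw => hin w ((List.drop_sublist _ _).subset hw), isHBridge_xstd hB2⟩,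
        by rw [length_xstd]; omega, ?_, ?_, ?_⟩
      · rw [npieces_xstd]; have := npieces_sndP hren; omega
      · rw [hdLev, head?_xstd hv2, Option.getD_some, hcc, hcz]; simp [lev, bit]
      · rw [ltLev, xstd, List.getLast?_map, List.getLast?_eq_some_getLast hne2, Option.map_some, Option.getD_some, lev_shift_zero, e4]
        rw [ltLev, List.getLast?_eq_some_getLast hl, Option.getD_some] at hb; exact hb
  -- injectivity and weights
  have hinj : Set.InjOn (fun l : List HV => (fstP l, xstd (sndP l))) (S : Set (List HV)) :=
    fun l hl l' hl' h => split_injOn (hmemS l hl).2.2.2.2.2.2.2.2.2.2 (hmemS l' hl').2.2.2.2.2.2.2.2.2.2 h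
  calc Dk T N (k + 1) (a : ℕ) (b : ℕ) y = ∑ l ∈ S, wD T y (fstP l) * wD T y (xstd (sndP l)) := by
        rw [Dk, ← hS]
        refine sum_congr rfl fun l hl => ?_
        rw [wD_eq_mul_fstP_sndP T y (hmemS l hl).2.2.2.2.2.2.2.2.2.2]
        congr 1
        rw [wD, wD, length_xstd, xstd, ← List.map_tail, topCnt_map_shift]
    _ = ∑ pq ∈ S.image fun l => (fstP l, xstd (sndP l)), wD T y pq.1 * wD T y pq.2 := by rw [sum_image hinj]
    _ ≤ ∑ pq ∈ tgt, wD T y pq.1 * wD T y pq.2 := by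
        refine sum_le_sum_of_subset_of_nonneg (fun pq hpq => ?_) fun pq _ _ => mul_nonneg (wD_nonneg T hy _) (wD_nonneg T hy _)
        rw [mem_image] at hpq
        obtain ⟨l, hl, rfl⟩ := hpq
        exact himg l hl
    _ = ∑ c : Fin (2 * T), Imat T N y a c * Dmat T N k y c b := by
        rw [htgt, sum_biUnion]
        · refine sum_congr rfl fun c _ => ?_
          rw [sum_product, Imat, Dmat, Dk, Dk, sum_mul_sum]
        · -- products for different junction levels are disjoint
          intro c _ c' _ hcc'
          rw [Function.onFun, disjoint_left]
          intro pq h1 h2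
          rw [mem_product, HBk, mem_filter] at h1 h2
          have e1 := h1.1.2.2.2.2; have e2 := h2.1.2.2.2.2
          apply hcc'
          exact Fin.ext (by have := e1.symm.trans e2; exact_mod_cast this)

/-- Matrix product is monotone in the right factor for a non-negative left factor. [cite: Seneta1973, §1.1] -/
theorem mul_apply_le_of_le {ι : Type*} [Fintype ι] {A B B' : Matrix ι ι ℝ} (hA : ∀ a b, 0 ≤ A a b) (hB : ∀ a b, B a b ≤ B' a b)
    (a b : ι) : (A * B) a b ≤ (A * B') a b := by
  rw [Matrix.mul_apply, Matrix.mul_apply]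
  exact sum_le_sum fun c _ => mul_le_mul_of_nonneg_left (hB c b) (hA a c)

/-- `I_N(y) ≥ 0` and `D^{(k)} ≥ 0` entrywise for `y ≥ 0`. [cite: DuminilCopinHammond2013, §2.2 (bridges of the strip); lane plumbing] -/
theorem Imat_Dmat_nonneg (hy : 0 ≤ y) (a b : Fin (2 * T)) : 0 ≤ Imat T N y a b ∧ 0 ≤ Dmat T N k y a b :=
  ⟨sum_nonneg fun l _ => wD_nonneg T hy l, sum_nonneg fun l _ => wD_nonneg T hy l⟩

/-- ★ **`D^{(k)}_N ≤ I_N^k`** entrywise (`k ≥ 1`, `y ≥ 0`). [cite: DuminilCopinHammond2013, §2.2 (unique decomposition into irreducible bridges)] -/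
theorem Dmat_le_pow (hy : 0 ≤ y) : ∀ k, 1 ≤ k → ∀ a b : Fin (2 * T), Dmat T N k y a b ≤ (Imat T N y ^ k) a b := by
  intro k hk
  induction k with
  | zero => omega
  | succ k ih =>
    intro a b
    rcases Nat.eq_zero_or_pos k with rfl | hkpos
    · simp only [zero_add, pow_one, Dmat, Imat]; exact le_rfl
    · calc Dmat T N (k + 1) y a b ≤ ∑ c, Imat T N y a c * Dmat T N k y c b := Dk_succ_le_sum hy hkpos a b
        _ = (Imat T N y * Dmat T N k y) a b := by rw [Matrix.mul_apply]
        _ ≤ (Imat T N y * Imat T N y ^ k) a b :=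
            mul_apply_le_of_le (fun a b => (Imat_Dmat_nonneg (N := N) (k := k) hy a b).1) (fun c d => ih (by omega) c d) a b
        _ = (Imat T N y ^ (k + 1)) a b := by rw [pow_succ']

end Sums


/-! ### §4 The concatenation inequality and bounded partial sums of `Σ_k I_N(y)^k` below `y_T` -/

section ConcatIneq

variable {T N M k : ℕ} {y : ℝ}

/-- `xstd` of a list whose head is already on the column `x₀ = 0` is the list. [cite: DuminilCopinHammond2013, §2.2 (bridges of the strip); lane plumbing] -/
theorem xstd_eq_self_of_head {l : List HV} {v : HV} (hv : l.head? = some v) (hv0 : v.1 = 0) : xstd l = l := by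
  rw [xstd, List.headD_eq_head?_getD, hv, Option.getD_some, hv0, neg_zero]
  conv_rhs => rw [← List.map_id l]
  refine List.map_congr_left fun w _ => ?_
  obtain ⟨x, y', c⟩ := w
  simp

/-- `xstd` is invariant under horizontal translation. [cite: DuminilCopinHammond2013, §2.2 (bridges of the strip); lane plumbing] -/
theorem xstd_map_shift (a : ℤ) (l : List HV) : xstd (l.map (shift a 0)) = xstd l := by
  cases l with
  | nil => rfl
  | cons v l =>
    obtain ⟨x, y', c⟩ := v
    simp only [xstd, List.map_cons, List.headD_cons, List.map_map, shift_apply]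
    congr 1
    · ext <;> simp
    · refine List.map_congr_left fun w _ => ?_
      obtain ⟨x₁, y₁, c₁⟩ := w
      simp only [Function.comp_apply, shift_apply]
      ext <;> simp

/-- `wD` is invariant under horizontal translation. [cite: DuminilCopinHammond2013, §2.2 (bridges of the strip); lane plumbing] -/
theorem wD_map_shift (T : ℕ) (y : ℝ) (a : ℤ) (l : List HV) : wD T y (l.map (shift a 0)) = wD T y l := by
  rw [wD, wD, List.length_map, ← List.map_tail, topCnt_map_shift]

set_option maxHeartbeats 400000 in
/-- ★ **Concatenation inequality**: an irreducible bridge from `a` to `c` (≤ N+1 vertices) followed by a `k`-piece bridge from `c`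
to `b` (≤ M+1 vertices) is a `(k+1)`-piece bridge from `a` to `b` (≤ N+M+1 vertices), injectively and with multiplicative
weights: `(I_N · D^{(k)}_M)(a,b) ≤ D^{(k+1)}_{N+M}(a,b)`. [cite: DuminilCopinHammond2013, §2.2 (concatenation of bridges)] -/
theorem Imat_mul_Dmat_le (hy : 0 ≤ y) (a b : Fin (2 * T)) :
    (Imat T N y * Dmat T M k y) a b ≤ Dmat T (N + M) (k + 1) y a b := by
  classical
  set src : Finset (List HV × List HV) :=
    (Finset.univ : Finset (Fin (2 * T))).biUnion fun c => HBk T N 1 (a : ℕ) (c : ℕ) ×ˢ HBk T M k (c : ℕ) (b : ℕ) with hsrc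
  -- unpack the source
  have hmem : ∀ pq ∈ src, ∃ c : Fin (2 * T), pq.1 ∈ HBk T N 1 (a : ℕ) (c : ℕ) ∧ pq.2 ∈ HBk T M k (c : ℕ) (b : ℕ) := by
    intro pq hpq
    rw [hsrc, mem_biUnion] at hpq
    obtain ⟨c, -, h⟩ := hpq
    exact ⟨c, (mem_product.1 h).1, (mem_product.1 h).2⟩
  have hspec : ∀ pq ∈ src,
      (hcat pq.1 pq.2).IsChain hvGraph.Adj ∧ (hcat pq.1 pq.2).Nodup ∧ InLev T (hcat pq.1 pq.2) ∧ IsHBridge (hcat pq.1 pq.2) ∧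
      (hcat pq.1 pq.2).length = pq.1.length + pq.2.length - 1 ∧ (hcat pq.1 pq.2).head? = pq.1.head? ∧
      (renIdxs (hcat pq.1 pq.2)).Nonempty ∧ fIdx (hcat pq.1 pq.2) = pq.1.length - 1 ∧ fstP (hcat pq.1 pq.2) = pq.1 ∧
      sndP (hcat pq.1 pq.2) = pq.2.map (shift (pq.1.getLast?.getD hvOrigin).1 0) := by
    intro pq hpq
    obtain ⟨c, hp, hq⟩ := hmem pq hpq
    rw [HBk, mem_filter, mem_hBridgesN_iff] at hp hq
    obtain ⟨⟨hpc, hpn, -, ⟨vp, hvp, hvp0⟩, hpin, hpB⟩, hp2, hpk, -, hpc'⟩ := hp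
    obtain ⟨⟨hqc, hqn, -, ⟨vq, hvq, hvq0⟩, hqin, hqB⟩, hq2, -, hqa, -⟩ := hq
    refine hcat_spec hpc hpn hpin hpB ?_ hp2 hqc hqn hqin hqB hq2 (fun hq => ?_) (fun hp hq => ?_)
    · rw [npieces] at hpk
      exact Finset.card_eq_zero.1 (by omega)
    · have : pq.2.head hq = vq := by rw [← Option.some_inj, ← List.head?_eq_some_head, hvq]
      rw [this]; exact hvq0
    · rw [ltLev, List.getLast?_eq_some_getLast hp, Option.getD_some] at hpc'
      rw [hdLev, List.head?_eq_some_head hq, Option.getD_some] at hqa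
      rw [hpc', hqa]
  -- image in the target class
  have himg : ∀ pq ∈ src, hcat pq.1 pq.2 ∈ HBk T (N + M) (k + 1) (a : ℕ) (b : ℕ) := by
    intro pq hpq
    obtain ⟨c, hp, hq⟩ := hmem pq hpq
    obtain ⟨hc, hnd, hin, hB, hlen, hhead, hren, hf, hfst, hsnd⟩ := hspec pq hpq
    rw [HBk, mem_filter, mem_hBridgesN_iff] at hp hq ⊢
    obtain ⟨⟨-, -, hplen, ⟨vp, hvp, hvp0⟩, -, -⟩, hp2, -, hpa, -⟩ := hp
    obtain ⟨⟨-, hqn, hqlen, ⟨vq, hvq, -⟩, -, -⟩, hq2, hqk, -, hqb⟩ := hq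
    have hqne : pq.2 ≠ [] := List.ne_nil_of_length_pos (by omega)
    have hne : hcat pq.1 pq.2 ≠ [] := List.ne_nil_of_length_pos (by rw [hlen]; omega)
    refine ⟨⟨hc, hnd, by rw [hlen]; omega, ⟨vp, by rw [hhead, hvp], hvp0⟩, hin, hB⟩, by rw [hlen]; omega, ?_, ?_, ?_⟩
    · have h1 := npieces_sndP hren
      rw [hsnd, ← npieces_xstd, xstd_map_shift, npieces_xstd] at h1
      omega
    · rw [hdLev, hhead]; rw [hdLev] at hpa; exact hpa
    · rw [ltLev, List.getLast?_eq_some_getLast hne, Option.getD_some]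
      have hsne : sndP (hcat pq.1 pq.2) ≠ [] := by rw [hsnd]; simpa using hqne
      have e : (hcat pq.1 pq.2).getLast hne = (sndP (hcat pq.1 pq.2)).getLast hsne := by
        rw [((fstP_sndP_ends hren).2.2.2 _)]
      rw [e]
      have e2 : (sndP (hcat pq.1 pq.2)).getLast hsne = shift (pq.1.getLast?.getD hvOrigin).1 0 (pq.2.getLast hqne) := by
        simp only [hsnd, List.getLast_map]
      rw [e2, lev_shift_zero]
      rw [ltLev, List.getLast?_eq_some_getLast hqne, Option.getD_some] at hqb
      exact hqb
  -- injectivity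
  have hinj : Set.InjOn (fun pq : List HV × List HV => hcat pq.1 pq.2) (src : Set (List HV × List HV)) := by
    intro pq hpq pq' hpq' heq
    obtain ⟨-, -, -, -, -, -, -, -, hfst, hsnd⟩ := hspec pq hpq
    obtain ⟨-, -, -, -, -, -, -, -, hfst', hsnd'⟩ := hspec pq' hpq'
    obtain ⟨c, hp, hq⟩ := hmem pq hpq
    obtain ⟨c', hp', hq'⟩ := hmem pq' hpq'
    rw [HBk, mem_filter, mem_hBridgesN_iff] at hq hq'
    obtain ⟨⟨-, -, -, ⟨vq, hvq, hvq0⟩, -, -⟩, -⟩ := hq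
    obtain ⟨⟨-, -, -, ⟨vq', hvq', hvq0'⟩, -, -⟩, -⟩ := hq'
    simp only at heq
    have h1 : pq.1 = pq'.1 := by rw [← hfst, ← hfst', heq]
    have h2 : pq.2 = pq'.2 := by
      have e := congrArg (fun l => xstd (sndP l)) heq
      simp only [hsnd, hsnd', xstd_map_shift, xstd_eq_self_of_head hvq hvq0, xstd_eq_self_of_head hvq' hvq0'] at e
      exact e
    exact Prod.ext h1 h2
  -- weights
  have hwt : ∀ pq ∈ src, wD T y pq.1 * wD T y pq.2 = wD T y (hcat pq.1 pq.2) := by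
    intro pq hpq
    obtain ⟨-, -, -, -, -, -, hren, -, hfst, hsnd⟩ := hspec pq hpq
    rw [wD_eq_mul_fstP_sndP T y hren, hfst, hsnd, wD_map_shift]
  calc (Imat T N y * Dmat T M k y) a b = ∑ c, Imat T N y a c * Dmat T M k y c b := Matrix.mul_apply
    _ = ∑ pq ∈ src, wD T y pq.1 * wD T y pq.2 := by
        rw [hsrc, sum_biUnion]
        · refine sum_congr rfl fun c _ => ?_
          rw [Imat, Dmat, Dk, Dk, sum_mul_sum, sum_product]
        · intro c _ c' _ hcc'
          rw [Function.onFun, disjoint_left]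
          intro pq h1 h2
          rw [mem_product, HBk, mem_filter] at h1 h2
          have e1 := h1.1.2.2.2.2; have e2 := h2.1.2.2.2.2
          exact hcc' (Fin.ext (by have := e1.symm.trans e2; exact_mod_cast this))
    _ = ∑ pq ∈ src, wD T y (hcat pq.1 pq.2) := sum_congr rfl hwt
    _ = ∑ h ∈ src.image fun pq => hcat pq.1 pq.2, wD T y h := by rw [sum_image hinj]
    _ ≤ Dmat T (N + M) (k + 1) y a b := by
        rw [Dmat, Dk]
        refine sum_le_sum_of_subset_of_nonneg (fun h hh => ?_) fun _ _ _ => wD_nonneg T hy _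
        rw [mem_image] at hh
        obtain ⟨pq, hpq, rfl⟩ := hh
        exact himg pq hpq

/-- The classes grow with the truncation. [cite: DuminilCopinHammond2013, §2.2 (bridges of the strip); lane plumbing] -/
theorem HBk_mono {M M' : ℕ} (h : M ≤ M') (k : ℕ) (a b : ℤ) : HBk T M k a b ⊆ HBk T M' k a b := by
  intro l hl
  rw [HBk, mem_filter, mem_hBridgesN_iff] at hl ⊢
  obtain ⟨⟨h1, h2, h3, h4, h5, h6⟩, h7⟩ := hl
  exact ⟨⟨h1, h2, by omega, h4, h5, h6⟩, h7⟩

/-- ★ **Powers of the irreducible matrix are dominated by bridge weights**: `(I_N(y)^k)_{ab} ≤ D^{(k)}_{kN}(a,b)(y)` (`k ≥ 1`).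
[cite: DuminilCopinHammond2013, §2.2 (concatenation)] -/
theorem pow_Imat_le_Dmat (hy : 0 ≤ y) : ∀ k, 1 ≤ k → ∀ a b : Fin (2 * T), (Imat T N y ^ k) a b ≤ Dmat T (k * N) k y a b := by
  intro k hk
  induction k with
  | zero => omega
  | succ k ih =>
    intro a b
    rcases Nat.eq_zero_or_pos k with rfl | hkpos
    · simp only [zero_add, pow_one, one_mul, Dmat, Imat]; exact le_rfl
    · calc (Imat T N y ^ (k + 1)) a b = (Imat T N y * Imat T N y ^ k) a b := by rw [pow_succ']
        _ ≤ (Imat T N y * Dmat T (k * N) k y) a b :=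
            mul_apply_le_of_le (fun a b => (Imat_Dmat_nonneg (N := N) (k := k) hy a b).1) (fun c d => ih hkpos c d) a b
        _ ≤ Dmat T (N + k * N) (k + 1) y a b := Imat_mul_Dmat_le hy a b
        _ = Dmat T ((k + 1) * N) (k + 1) y a b := by rw [show N + k * N = (k + 1) * N by ring]

/-- All bridges from `a` to `b`: the `k`-piece classes are disjoint parts. [cite: DuminilCopinHammond2013, §2.2] -/
theorem sum_Dk_le_Dab (hy : 0 ≤ y) (n : ℕ) (a b : ℤ) : ∑ k ∈ range n, Dk T M (k + 1) a b y ≤ Dab T M a b y := by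
  classical
  rw [Dab]
  have hdisj : Set.PairwiseDisjoint (range n : Set ℕ) fun k => HBk T M (k + 1) a b := by
    intro i _ j _ hij
    rw [Function.onFun, disjoint_left]
    intro l h1 h2
    rw [HBk, mem_filter] at h1 h2
    exact hij (by have := h1.2.2.1.symm.trans h2.2.2.1; omega)
  calc ∑ k ∈ range n, Dk T M (k + 1) a b y = ∑ l ∈ (range n).biUnion fun k => HBk T M (k + 1) a b, wD T y l := by
        rw [sum_biUnion hdisj]; rfl
    _ ≤ ∑ l ∈ HBab T M a b, wD T y l := by
        refine sum_le_sum_of_subset_of_nonneg (fun l hl => ?_) fun _ _ _ => wD_nonneg T hy _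
        rw [mem_biUnion] at hl
        obtain ⟨k, -, hk⟩ := hl
        rw [HBk, mem_filter] at hk
        rw [HBab, mem_filter]
        exact ⟨hk.1, hk.2.1, hk.2.2.2⟩

/-- ★ **All horizontal bridges have bounded total weight below the threshold of the width-`T` strip**:
`D_M(a,b)(y) ≤ Σ_{m ≤ M} x_c^m Z_{T,m}(y)` (`y ≥ 1`), which is bounded when `x_c ν_T(y) < 1`.
[cite: BeatonBousquetMelouDeGierDuminilCopinGuttmann2014, Corollary 8 (strip series converge below y_T)] -/
theorem Dab_le_partialSum_stripZL (hy1 : 1 ≤ y) (a b : ℤ) :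
    Dab T M a b y ≤ ∑ m ∈ range (M + 1), hexCriticalFugacity ^ m * stripZL T m y := by
  classical
  have hy0 : 0 ≤ y := by linarith
  have hx := hexCriticalFugacity_pos_lt_one.1.le
  calc Dab T M a b y ≤ ∑ l ∈ (range (M + 1)).biUnion fun m => stripChains T m, wD T y l := by
        refine sum_le_sum_of_subset_of_nonneg (fun l hl => ?_) fun _ _ _ => wD_nonneg T hy0 _
        rw [HBab, mem_filter, hBridgesN, mem_filter] at hl
        exact hl.1.1
    _ = ∑ m ∈ range (M + 1), ∑ l ∈ stripChains T m, wD T y l := sum_biUnion (LinLow.disj_stripChains T _)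
    _ ≤ ∑ m ∈ range (M + 1), hexCriticalFugacity ^ m * stripZL T m y := by
        refine sum_le_sum fun m _ => ?_
        rw [stripZL, mul_sum]
        refine sum_le_sum fun l hl => ?_
        have hlen := (mem_stripChains_iff.1 hl).2.2.1
        rw [wD, hlen, Nat.add_sub_cancel]
        refine mul_le_mul_of_nonneg_left (pow_le_pow_right₀ hy1 ?_) (pow_nonneg hx _)
        rw [topCnt, topCnt]
        exact ((List.tail_sublist l).filter _).length_le

/-- ★ **Bounded partial sums**: for `1 ≤ y` with `x_c ν_T(y) < 1` there is `B` with `Σ_{k<n} (I_N(y)^k)_{ab} ≤ B` for ALL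
`n, N, a, b` (the input of the renewal-pole lemma). [cite: DuminilCopinHammond2013, §2.2; BeatonBousquetMelouDeGierDuminilCopinGuttmann2014, Corollary 8] -/
theorem exists_partialSum_pow_Imat_le (hT : 1 ≤ T) (hy1 : 1 ≤ y) (hν : hexCriticalFugacity * stripNu T y < 1) :
    ∃ B : ℝ, ∀ n N (a b : Fin (2 * T)), ∑ k ∈ range n, (Imat T N y ^ k) a b ≤ B := by
  have hy0 : 0 ≤ y := by linarith
  obtain ⟨C, hC⟩ := exists_partialSum_stripZL_le hT (by linarith) hν
  have hC0 : 0 ≤ C := le_trans (by simp) (hC 0)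
  refine ⟨1 + C, fun n N a b => ?_⟩
  cases n with
  | zero => simp; linarith
  | succ n =>
    rw [Finset.sum_range_succ', pow_zero]
    have h0 : (1 : Matrix (Fin (2 * T)) (Fin (2 * T)) ℝ) a b ≤ 1 := by
      rw [Matrix.one_apply]; split_ifs <;> norm_num
    have h1 : ∑ k ∈ range n, (Imat T N y ^ (k + 1)) a b ≤ C := by
      calc ∑ k ∈ range n, (Imat T N y ^ (k + 1)) a b ≤ ∑ k ∈ range n, Dk T (n * N) (k + 1) (a : ℕ) (b : ℕ) y := by
            refine sum_le_sum fun k hk => ?_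
            rw [mem_range] at hk
            refine (pow_Imat_le_Dmat hy0 (k + 1) (by omega) a b).trans ?_
            exact sum_le_sum_of_subset_of_nonneg (HBk_mono (Nat.mul_le_mul_right _ (by omega)) _ _ _)
              fun _ _ _ => wD_nonneg T hy0 _
        _ ≤ Dab T (n * N) (a : ℕ) (b : ℕ) y := sum_Dk_le_Dab hy0 n _ _
        _ ≤ _ := Dab_le_partialSum_stripZL hy1 _ _
        _ ≤ C := hC _
    linarith

end ConcatIneq


/-! ### §5 Irreducibility of the level graph: every level reaches every level through irreducible bridges -/

section Irreducible

variable {T : ℕ}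

/-- Reachability through positive entries of powers of a matrix (plumbing). [cite: Seneta1973, §1.1 (a → b iff some (A^j)_{ab} > 0); lane plumbing] -/
def Reach (P : Matrix (Fin (2 * T)) (Fin (2 * T)) ℝ) (a b : Fin (2 * T)) : Prop := ∃ j : ℕ, 0 < (P ^ j) a b

variable {P : Matrix (Fin (2 * T)) (Fin (2 * T)) ℝ}

/-- Reachability is reflexive. [cite: DuminilCopinHammond2013, §2.2 (bridges of the strip); lane plumbing] -/
theorem reach_refl (a : Fin (2 * T)) : Reach P a a := ⟨0, by simp⟩

/-- Reachability is transitive for a non-negative matrix. [cite: Seneta1973, §1.1 (chains of positive entries)] -/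
theorem reach_trans (hP : ∀ a b, 0 ≤ P a b) {a b c : Fin (2 * T)} (h1 : Reach P a b) (h2 : Reach P b c) : Reach P a c := by
  obtain ⟨i, hi⟩ := h1
  obtain ⟨j, hj⟩ := h2
  exact ⟨i + j, (mul_pos hi hj).trans_le (nonnegMat_mul_pow_apply_le_pow_add_apply hP i j a b c)⟩

/-- A positive entry gives reachability in one step. [cite: DuminilCopinHammond2013, §2.2 (bridges of the strip); lane plumbing] -/
theorem reach_of_pos {a b : Fin (2 * T)} (h : 0 < P a b) : Reach P a b := ⟨1, by simpa using h⟩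

/-- `0 < I_N(1)_{ab}` as soon as one irreducible bridge from level `a` to level `b` with at most `N + 1` vertices is exhibited.
[cite: DuminilCopinHammond2013, §2.2] -/
theorem Imat_pos_of_mem {N : ℕ} {a b : Fin (2 * T)} {a' b' : ℤ} {l : List HV} (hl : l ∈ HBk T N 1 a' b')
    (ha : a' = ((a : ℕ) : ℤ)) (hb : b' = ((b : ℕ) : ℤ)) : 0 < Imat T N 1 a b := by
  subst ha; subst hb
  rw [Imat, Dk]
  refine lt_of_lt_of_le ?_ (single_le_sum (f := fun l => wD T 1 l) (fun l _ => wD_nonneg T zero_le_one l) hl)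
  rw [wD, one_pow, mul_one]
  exact pow_pos hexCriticalFugacity_pos_lt_one.1 _

/-- A two-vertex right step is an irreducible standard bridge of the strip (levels permitting).
[cite: DuminilCopinHammond2013, §2.2; DuminilCopinSmirnov2012, §3 (the edges of ℍ in the strip)] -/
theorem pair_mem_HBk {N : ℕ} (hN : 1 ≤ N) {u v : HV} (hadj : hvGraph.Adj u v) (hu0 : u.1 = 0) (hxi : xi u < xi v)
    (hu : 0 ≤ lev u ∧ lev u ≤ 2 * (T : ℤ) - 1) (hv : 0 ≤ lev v ∧ lev v ≤ 2 * (T : ℤ) - 1) :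
    [u, v] ∈ HBk T N 1 (lev u) (lev v) := by
  have hne : u ≠ v := hadj.ne
  rw [HBk, mem_filter, mem_hBridgesN_iff]
  refine ⟨⟨?_, ?_, ?_, ⟨u, rfl, hu0⟩, ?_, ?_⟩, ?_, ?_, rfl, rfl⟩
  · simpa using hadj
  · simp [hne]
  · simp only [List.length_cons, List.length_nil]; omega
  · intro w hw
    simp only [List.mem_cons, List.not_mem_nil, or_false] at hw
    rcases hw with rfl | rfl
    · exact hu
    · exact hv
  · refine ⟨by simp, fun w hw => ?_⟩
    simp only [List.tail_cons, List.mem_cons, List.not_mem_nil, or_false] at hw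
    subst hw
    simp only [List.head_cons, List.getLast_cons_cons, List.getLast_singleton]
    exact ⟨hxi, le_rfl⟩
  · simp
  · rw [npieces, Finset.card_eq_zero.2]
    rw [renIdxs, Finset.filter_eq_empty_iff]
    intro i _ h
    have h0 := h.1
    have := h.2.1
    simp only [List.length_cons, List.length_nil] at this
    omega

/-- A three-vertex right step followed by a vertical step is an irreducible standard bridge of the strip (levels permitting).
[cite: DuminilCopinHammond2013, §2.2; DuminilCopinSmirnov2012, §3] -/
theorem triple_mem_HBk {N : ℕ} (hN : 2 ≤ N) {u v w : HV} (huv : hvGraph.Adj u v) (hvw : hvGraph.Adj v w) (hu0 : u.1 = 0)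
    (hxi1 : xi u < xi v) (hxi2 : xi v = xi w) (huw : lev u ≠ lev w)
    (hu : 0 ≤ lev u ∧ lev u ≤ 2 * (T : ℤ) - 1) (hv : 0 ≤ lev v ∧ lev v ≤ 2 * (T : ℤ) - 1)
    (hw : 0 ≤ lev w ∧ lev w ≤ 2 * (T : ℤ) - 1) :
    [u, v, w] ∈ HBk T N 1 (lev u) (lev w) := by
  have hne1 : u ≠ v := huv.ne
  have hne2 : v ≠ w := hvw.ne
  have hne3 : u ≠ w := fun h => huw (by rw [h])
  rw [HBk, mem_filter, mem_hBridgesN_iff]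
  refine ⟨⟨?_, ?_, ?_, ⟨u, rfl, hu0⟩, ?_, ?_⟩, ?_, ?_, rfl, rfl⟩
  · simp [huv, hvw]
  · simp [hne1, hne2, hne3]
  · simp only [List.length_cons, List.length_nil]; omega
  · intro z hz
    simp only [List.mem_cons, List.not_mem_nil, or_false] at hz
    rcases hz with rfl | rfl | rfl
    · exact hu
    · exact hv
    · exact hw
  · refine ⟨by simp, fun z hz => ?_⟩
    simp only [List.tail_cons, List.mem_cons, List.not_mem_nil, or_false] at hz
    simp only [List.head_cons, List.getLast_cons_cons, List.getLast_singleton]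
    rcases hz with rfl | rfl
    · exact ⟨hxi1, hxi2.le⟩
    · exact ⟨by rw [← hxi2]; exact hxi1, le_rfl⟩
  · simp
  · rw [npieces, Finset.card_eq_zero.2]
    rw [renIdxs, Finset.filter_eq_empty_iff]
    intro i _ h
    obtain ⟨h0, h1, -, h3⟩ := h
    simp only [List.length_cons, List.length_nil] at h1
    have hi1 : i = 1 := by omega
    subst hi1
    have := h3 2 (by simp) (by norm_num)
    rw [xiAt_eq_xi_getElem (by simp), xiAt_eq_xi_getElem (by simp)] at this
    simp only [List.getElem_cons_succ, List.getElem_cons_zero] at this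
    rw [hxi2] at this
    exact lt_irrefl _ this

/-- Levels of the explicit vertices (plumbing). [cite: DuminilCopinHammond2013, §2.2 (bridges of the strip); lane plumbing] -/
theorem lev_explicit (x : ℤ) (j : ℤ) :
    lev (x, j, false) = 2 * j ∧ lev (x, j, true) = 2 * j + 1 ∧ xi (x, j, false) = 2 * x + j ∧ xi (x, j, true) = 2 * x + j + 1 := by
  simp [xi, bit]

/-- ★ **Irreducibility of the level graph**: for `N ≥ 2` and every pair of levels `a, b` some power of `I_N(1)` has a positive
`(a, b)` entry — one-step right slants `2j → 2j+1`, `2j+1 → 2j` and two-step slant-then-vertical bridges `2j → 2j+2`,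
`2j+3 → 2j+1` are irreducible and connect all levels. [cite: DuminilCopinHammond2013, §2.2; Seneta1973, §1.1 (irreducible matrices)] -/
theorem reach_Imat_all (hT : 1 ≤ T) {N : ℕ} (hN : 2 ≤ N) (a b : Fin (2 * T)) : Reach (Imat T N 1) a b := by
  have hP : ∀ a b : Fin (2 * T), 0 ≤ Imat T N 1 a b := fun a b => (Imat_Dmat_nonneg (k := 1) zero_le_one a b).1
  have hA : ∀ (x j : ℤ), hvGraph.Adj (x, j, false) (x, j, true) := fun x j => by simp [hvGraph_adj, AdjRel]
  have hB : ∀ (x j : ℤ), hvGraph.Adj (x, j, true) (x + 1, j, false) := fun x j => by simp [hvGraph_adj, AdjRel]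
  have hC : ∀ (x j : ℤ), hvGraph.Adj (x, j, true) (x, j + 1, false) := fun x j => by simp [hvGraph_adj, AdjRel]
  have hC' : ∀ (x j : ℤ), hvGraph.Adj (x + 1, j, false) (x + 1, j - 1, true) := fun x j => by
    simp [hvGraph_adj, AdjRel]
  -- the moves between consecutive levels `m`, `m + 1`
  have key : ∀ (m : ℕ) (hm : m + 1 < 2 * T),
      Reach (Imat T N 1) ⟨m, by omega⟩ ⟨m + 1, hm⟩ ∧ Reach (Imat T N 1) ⟨m + 1, hm⟩ ⟨m, by omega⟩ := by
    intro m hm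
    rcases Nat.even_or_odd m with ⟨j, hj⟩ | ⟨j, hj⟩
    · -- `m = j + j` even: up-slant `m → m+1`, down-slant `m+1 → m`
      obtain ⟨l1, l2, x1, x2⟩ := lev_explicit 0 (j : ℤ)
      obtain ⟨l3, -, x3, -⟩ := lev_explicit 1 (j : ℤ)
      have h1 := pair_mem_HBk (T := T) (N := N) (by omega) (hA 0 j) rfl (by rw [x1, x2]; omega)
        (by rw [l1]; omega) (by rw [l2]; omega)
      have h2 := pair_mem_HBk (T := T) (N := N) (by omega) (by simpa using hB 0 j) rfl (by rw [x2, x3]; omega)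
        (by rw [l2]; omega) (by rw [l3]; omega)
      exact ⟨reach_of_pos (Imat_pos_of_mem h1 (by rw [l1]; simp; omega) (by rw [l2]; simp; omega)),
        reach_of_pos (Imat_pos_of_mem h2 (by rw [l2]; simp; omega) (by rw [l3]; simp; omega))⟩
    · -- `m = 2j+1` odd: `m → m−1 → m+1` and `m+1 → m+2 → m`
      obtain ⟨l0f, l0t, x0f, x0t⟩ := lev_explicit 0 (j : ℤ)
      obtain ⟨l1f, -, x1f, -⟩ := lev_explicit 1 (j : ℤ)
      obtain ⟨l0f', l0t', x0f', x0t'⟩ := lev_explicit 0 ((j : ℤ) + 1)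
      obtain ⟨l1f', -, x1f', -⟩ := lev_explicit 1 ((j : ℤ) + 1)
      have l1t : lev ((1 : ℤ), (j : ℤ), true) = 2 * (j : ℤ) + 1 := by simp [bit]
      have x1t : xi ((1 : ℤ), (j : ℤ), true) = 2 * 1 + (j : ℤ) + 1 := by simp [xi, bit]
      -- `m → m−1`
      have h1 := pair_mem_HBk (T := T) (N := N) (by omega) (by simpa using hB 0 j) rfl (by rw [x0t, x1f]; omega)
        (by rw [l0t]; omega) (by rw [l1f]; omega)
      -- `m−1 → m+1`
      have h2 := triple_mem_HBk (T := T) (N := N) hN (hA 0 j) (hC 0 j) rfl (by rw [x0f, x0t]; omega)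
        (by rw [x0t, x0f']; omega) (by rw [l0f, l0f']; omega) (by rw [l0f]; omega) (by rw [l0t]; omega) (by rw [l0f']; omega)
      -- `m+1 → m+2`
      have h3 := pair_mem_HBk (T := T) (N := N) (by omega) (hA 0 (j + 1)) rfl (by rw [x0f', x0t']; omega)
        (by rw [l0f']; omega) (by rw [l0t']; omega)
      -- `m+2 → m` : `(0,j+1,true) → (1,j+1,false) → (1,j,true)`
      have h4 := triple_mem_HBk (T := T) (N := N) hN (by simpa using hB 0 (j + 1))
        (by have := hC' 0 ((j : ℤ) + 1); simpa using this) rfl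
        (by rw [x0t', x1f']; omega) (by rw [x1f', x1t]; omega) (by rw [l0t', l1t]; omega)
        (by rw [l0t']; omega) (by rw [l1f']; omega) (by rw [l1t]; omega)
      refine ⟨reach_trans hP (reach_of_pos (Imat_pos_of_mem (b := ⟨2 * j, by omega⟩) h1 (by rw [l0t]; simp; omega)
            (by rw [l1f]; simp)))
          (reach_of_pos (Imat_pos_of_mem (a := ⟨2 * j, by omega⟩) h2 (by rw [l0f]; simp) (by rw [l0f']; simp; omega))),
        reach_trans hP (reach_of_pos (Imat_pos_of_mem (b := ⟨2 * j + 1 + 2, by omega⟩) h3 (by rw [l0f']; simp; omega)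
            (by rw [l0t']; simp; omega)))
          (reach_of_pos (Imat_pos_of_mem (a := ⟨2 * j + 1 + 2, by omega⟩) h4 (by rw [l0t']; simp; omega)
            (by rw [l1t]; simp; omega)))⟩
  -- from `0` up to any level and back down
  have hup : ∀ (m : ℕ) (hm : m < 2 * T), Reach (Imat T N 1) ⟨0, by omega⟩ ⟨m, hm⟩ := by
    intro m
    induction m with
    | zero => intro hm; exact reach_refl _
    | succ m ih => intro hm; exact reach_trans hP (ih (by omega)) (key m hm).1
  have hdown : ∀ (m : ℕ) (hm : m < 2 * T), Reach (Imat T N 1) ⟨m, hm⟩ ⟨0, by omega⟩ := by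
    intro m
    induction m with
    | zero => intro hm; exact reach_refl _
    | succ m ih => intro hm; exact reach_trans hP (key m hm).2 (ih (by omega))
  exact reach_trans hP (hdown a a.isLt) (hup b b.isLt)

end Irreducible


/-! ### §6 The limit matrix `I(y) = sup_N I_N(y)` and the renewal-pole bound -/

section Pole

open Filter Topology

variable {T : ℕ} {y : ℝ}

/-- ★ **The matrix of ALL irreducible horizontal bridges** `I(y)_{ab} = sup_N I_N(y)_{ab}` (a real number below `y_T`).
[cite: DuminilCopinHammond2013, §2.2 (irreducible bridges); lane (MATHS-NOTE-k1-renewal [D])] -/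
def Iinf (T : ℕ) (y : ℝ) : Matrix (Fin (2 * T)) (Fin (2 * T)) ℝ := fun a b => ⨆ N : ℕ, Imat T N y a b

/-- `I_N(y)` grows with `N`. [cite: DuminilCopinHammond2013, §2.2 (bridges of the strip); lane plumbing] -/
theorem Imat_mono_N {N N' : ℕ} (h : N ≤ N') (hy : 0 ≤ y) (a b : Fin (2 * T)) : Imat T N y a b ≤ Imat T N' y a b :=
  sum_le_sum_of_subset_of_nonneg (HBk_mono h 1 _ _) fun _ _ _ => wD_nonneg T hy _

/-- `wD` is non-decreasing in `y ≥ 0`. [cite: DuminilCopinHammond2013, §2.2 (bridges of the strip); lane plumbing] -/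
theorem wD_mono {y y' : ℝ} (hy : 0 ≤ y) (hyy : y ≤ y') (l : List HV) : wD T y l ≤ wD T y' l :=
  mul_le_mul_of_nonneg_left (pow_le_pow_left₀ hy hyy _) (pow_nonneg hexCriticalFugacity_pos_lt_one.1.le _)

/-- `I_N(y)` is non-decreasing in `y ≥ 0`. [cite: DuminilCopinHammond2013, §2.2 (bridges of the strip); lane plumbing] -/
theorem Imat_mono_y {N : ℕ} {y y' : ℝ} (hy : 0 ≤ y) (hyy : y ≤ y') (a b : Fin (2 * T)) : Imat T N y a b ≤ Imat T N y' a b :=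
  sum_le_sum fun l _ => wD_mono hy hyy l

/-- Below the threshold the entries `I_N(y)_{ab}` are bounded uniformly in `N`. [cite: BeatonBousquetMelouDeGierDuminilCopinGuttmann2014, Corollary 8] -/
theorem exists_Imat_le (hT : 1 ≤ T) (hy1 : 1 ≤ y) (hν : hexCriticalFugacity * stripNu T y < 1) :
    ∃ B : ℝ, ∀ N (a b : Fin (2 * T)), Imat T N y a b ≤ B := by
  obtain ⟨B, hB⟩ := exists_partialSum_pow_Imat_le hT hy1 hν
  refine ⟨B, fun N a b => ?_⟩
  have h := hB 2 N a b
  rw [sum_range_succ, sum_range_one, pow_zero, pow_one] at h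
  have h1 : 0 ≤ (1 : Matrix (Fin (2 * T)) (Fin (2 * T)) ℝ) a b := by rw [Matrix.one_apply]; split_ifs <;> norm_num
  linarith

/-- Threshold facts for `y ∈ [1, y_T)`. [cite: BeatonBousquetMelouDeGierDuminilCopinGuttmann2014, Corollary 8] -/
theorem sub_threshold_of_mem_Ico (hT : 1 ≤ T) (hy : y ∈ Set.Ico 1 (stripYT T)) :
    1 ≤ y ∧ 0 ≤ y ∧ hexCriticalFugacity * stripNu T y < 1 := by
  obtain ⟨hy1, hyT⟩ := hy
  refine ⟨hy1, by linarith, ?_⟩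
  have hx := hexCriticalFugacity_pos_lt_one
  have h := (stripNu_lt_inv_iff hT (by linarith)).2 hyT
  calc hexCriticalFugacity * stripNu T y < hexCriticalFugacity * hexCriticalFugacity⁻¹ := mul_lt_mul_of_pos_left h hx.1
    _ = 1 := mul_inv_cancel₀ hx.1.ne'

/-- `BddAbove` of `N ↦ I_N(y)_{ab}` below the threshold. [cite: DuminilCopinHammond2013, §2.2 (bridges of the strip); lane plumbing] -/
theorem bddAbove_Imat (hT : 1 ≤ T) (hy : y ∈ Set.Ico 1 (stripYT T)) (a b : Fin (2 * T)) :
    BddAbove (Set.range fun N => Imat T N y a b) := by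
  obtain ⟨hy1, -, hν⟩ := sub_threshold_of_mem_Ico hT hy
  obtain ⟨B, hB⟩ := exists_Imat_le hT hy1 hν
  exact ⟨B, by rintro _ ⟨N, rfl⟩; exact hB N a b⟩

/-- `I_N(y) ≤ I(y)` entrywise below the threshold. [cite: DuminilCopinHammond2013, §2.2 (bridges of the strip); lane plumbing] -/
theorem Imat_le_Iinf (hT : 1 ≤ T) (hy : y ∈ Set.Ico 1 (stripYT T)) (N : ℕ) (a b : Fin (2 * T)) :
    Imat T N y a b ≤ Iinf T y a b := le_ciSup (bddAbove_Imat hT hy a b) N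

/-- `I(y) ≥ 0` entrywise below the threshold. [cite: DuminilCopinHammond2013, §2.2 (bridges of the strip); lane plumbing] -/
theorem Iinf_nonneg (hT : 1 ≤ T) (hy : y ∈ Set.Ico 1 (stripYT T)) (a b : Fin (2 * T)) : 0 ≤ Iinf T y a b :=
  ((Imat_Dmat_nonneg (N := 0) (k := 1) (sub_threshold_of_mem_Ico hT hy).2.1 a b).1).trans (Imat_le_Iinf hT hy 0 a b)

/-- `I_N(y)_{ab} → I(y)_{ab}` (monotone convergence). [cite: DuminilCopinHammond2013, §2.2 (bridges of the strip); lane plumbing] -/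
theorem tendsto_Imat (hT : 1 ≤ T) (hy : y ∈ Set.Ico 1 (stripYT T)) (a b : Fin (2 * T)) :
    Tendsto (fun N => Imat T N y a b) atTop (𝓝 (Iinf T y a b)) :=
  tendsto_atTop_ciSup (fun _ _ h => Imat_mono_N h (sub_threshold_of_mem_Ico hT hy).2.1 a b) (bddAbove_Imat hT hy a b)

/-- Powers converge entrywise: `(I_N(y)^k)_{ab} → (I(y)^k)_{ab}` (finite sums and products). [cite: DuminilCopinHammond2013, §2.2 (bridges of the strip); lane plumbing] -/
theorem tendsto_Imat_pow (hT : 1 ≤ T) (hy : y ∈ Set.Ico 1 (stripYT T)) (k : ℕ) :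
    ∀ a b : Fin (2 * T), Tendsto (fun N => (Imat T N y ^ k) a b) atTop (𝓝 ((Iinf T y ^ k) a b)) := by
  induction k with
  | zero => intro a b; simp only [pow_zero]; exact tendsto_const_nhds
  | succ k ih =>
    intro a b
    simp only [pow_succ, Matrix.mul_apply]
    exact tendsto_finsetSum _ fun c _ => (ih a c).mul (tendsto_Imat hT hy c b)

/-- Bounded partial sums for the limit matrix: `Σ_{k<n} (I(y)^k)_{ab} ≤ B(y)` for `y ∈ [1, y_T)`.
[cite: DuminilCopinHammond2013, §2.2; BeatonBousquetMelouDeGierDuminilCopinGuttmann2014, Corollary 8] -/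
theorem exists_partialSum_pow_Iinf_le (hT : 1 ≤ T) (hy : y ∈ Set.Ico 1 (stripYT T)) :
    ∃ B : ℝ, ∀ n (a b : Fin (2 * T)), (∑ k ∈ range n, Iinf T y ^ k) a b ≤ B := by
  obtain ⟨hy1, -, hν⟩ := sub_threshold_of_mem_Ico hT hy
  obtain ⟨B, hB⟩ := exists_partialSum_pow_Imat_le hT hy1 hν
  refine ⟨B, fun n a b => ?_⟩
  rw [Matrix.sum_apply]
  have hlim : Tendsto (fun N => ∑ k ∈ range n, (Imat T N y ^ k) a b) atTop (𝓝 (∑ k ∈ range n, (Iinf T y ^ k) a b)) :=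
    tendsto_finsetSum _ fun k _ => tendsto_Imat_pow hT hy k a b
  exact le_of_tendsto' hlim fun N => hB n N a b

/-- The one-step bridge to the top wall: `[(0, T−1, false), (0, T−1, true)]` is irreducible from level `2T−2` to `2T−1` with
weight `x_c · y`. [cite: BeatonBousquetMelouDeGierDuminilCopinGuttmann2014, §4 (a surface contact weighs y)] -/
theorem topStep_mem (hT : 1 ≤ T) {N : ℕ} (hN : 1 ≤ N) :
    [((0 : ℤ), ((T : ℤ) - 1), false), ((0 : ℤ), ((T : ℤ) - 1), true)] ∈ HBk T N 1 (2 * (T : ℤ) - 2) (2 * (T : ℤ) - 1) ∧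
    ∀ y : ℝ, wD T y [((0 : ℤ), ((T : ℤ) - 1), false), ((0 : ℤ), ((T : ℤ) - 1), true)] = hexCriticalFugacity * y := by
  obtain ⟨l1, l2, x1, x2⟩ := lev_explicit 0 ((T : ℤ) - 1)
  have h := pair_mem_HBk (T := T) (N := N) hN (u := ((0 : ℤ), ((T : ℤ) - 1), false)) (v := ((0 : ℤ), ((T : ℤ) - 1), true))
    (by simp [hvGraph_adj, AdjRel]) rfl (by rw [x1, x2]; omega) (by rw [l1]; omega) (by rw [l2]; omega)
  rw [l1, l2, show 2 * ((T : ℤ) - 1) = 2 * (T : ℤ) - 2 by ring, show 2 * (T : ℤ) - 2 + 1 = 2 * (T : ℤ) - 1 by ring] at h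
  refine ⟨h, fun y => ?_⟩
  rw [wD]
  simp only [List.length_cons, List.length_nil, List.tail_cons, topCnt_singleton, l2]
  rw [if_pos (by ring)]
  simp

/-- ★★ **The renewal-pole bound for the irreducible matrix of the strip**: there is `C` with
`Σ_{k<n} (I(y)^k)_{ab} ≤ C/(y_T − y)` for all `y ∈ [1, y_T)`, `n`, `a`, `b` — by the tree lemma
`nonnegMat_exists_partialSum_pow_apply_le_div` (non-negative, non-decreasing, irreducible at `y = 1`, slope `x_c` at the
entry `(2T−2, 2T−1)`, bounded partial sums below `y_T`). [cite: DuminilCopinHammond2013, §2.2; Seneta1973, Theorem 6.1] -/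
theorem exists_partialSum_pow_Iinf_le_div (hT : 1 ≤ T) :
    ∃ C : ℝ, ∀ y ∈ Set.Ico (1 : ℝ) (stripYT T), ∀ n (a b : Fin (2 * T)),
      (∑ k ∈ range n, Iinf T y ^ k) a b ≤ C / (stripYT T - y) := by
  have hx := hexCriticalFugacity_pos_lt_one
  have h1T := one_lt_stripYT hT
  have h1mem : (1 : ℝ) ∈ Set.Ico (1 : ℝ) (stripYT T) := ⟨le_rfl, h1T⟩
  have h2T : 2 * T - 2 < 2 * T := by omega
  have h2T' : 2 * T - 1 < 2 * T := by omega
  have h0T : 0 < 2 * T := by omega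
  refine nonnegMat_exists_partialSum_pow_apply_le_div (fun y => Iinf T y) hx.1 (fun y hy a b => Iinf_nonneg hT hy a b)
    (fun y y' hy hy' hyy a b => ?_) (fun a b => ?_) (a₁ := ⟨2 * T - 2, h2T⟩) (b₁ := ⟨2 * T - 1, h2T'⟩)
    (fun y y' hy hy' hyy => ?_) (a₀ := ⟨0, h0T⟩) (b₀ := ⟨0, h0T⟩) (fun y hy => ?_)
  · -- monotone in `y`
    exact ciSup_le fun N => (Imat_mono_y (sub_threshold_of_mem_Ico hT hy).2.1 hyy a b).trans (Imat_le_Iinf hT hy' N a b)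
  · -- irreducible at `y = 1`
    obtain ⟨j, hj⟩ := reach_Imat_all hT (N := 2) le_rfl a b
    exact ⟨j, hj.trans_le (nonnegMat_pow_apply_mono (fun a b => (Imat_Dmat_nonneg (N := 2) (k := 1) zero_le_one a b).1)
      (fun a b => Imat_le_Iinf hT h1mem 2 a b) j a b)⟩
  · -- slope at the top step
    have hy0 := (sub_threshold_of_mem_Ico hT hy).2.1
    have key : ∀ N, Imat T N y ⟨2 * T - 2, h2T⟩ ⟨2 * T - 1, h2T'⟩ + hexCriticalFugacity * (y' - y) ≤
        Iinf T y' ⟨2 * T - 2, h2T⟩ ⟨2 * T - 1, h2T'⟩ := by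
      intro N
      obtain ⟨hmem, hw⟩ := topStep_mem hT (N := N + 1) (by omega)
      have e1 : (2 * (T : ℤ) - 2) = (((⟨2 * T - 2, h2T⟩ : Fin (2 * T)) : ℕ) : ℤ) := by simp; omega
      have e2 : (2 * (T : ℤ) - 1) = (((⟨2 * T - 1, h2T'⟩ : Fin (2 * T)) : ℕ) : ℤ) := by simp; omega
      rw [e1, e2] at hmem
      -- `I_{N}(y) + x_c (y' − y) ≤ I_{N+1}(y) + x_c(y'−y) ≤ I_{N+1}(y') ≤ I(y')`
      have hstep : Imat T (N + 1) y ⟨2 * T - 2, h2T⟩ ⟨2 * T - 1, h2T'⟩ + hexCriticalFugacity * (y' - y) ≤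
          Imat T (N + 1) y' ⟨2 * T - 2, h2T⟩ ⟨2 * T - 1, h2T'⟩ := by
        have hdiff : hexCriticalFugacity * y' - hexCriticalFugacity * y ≤
            Imat T (N + 1) y' ⟨2 * T - 2, h2T⟩ ⟨2 * T - 1, h2T'⟩ - Imat T (N + 1) y ⟨2 * T - 2, h2T⟩ ⟨2 * T - 1, h2T'⟩ := by
          rw [Imat, Imat, Dk, Dk, ← sum_sub_distrib, ← hw y', ← hw y]
          exact single_le_sum (f := fun l => wD T y' l - wD T y l) (fun l _ => sub_nonneg.2 (wD_mono hy0 hyy l)) hmem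
        linarith
      linarith [Imat_mono_N (Nat.le_succ N) hy0 (⟨2 * T - 2, h2T⟩ : Fin (2 * T)) ⟨2 * T - 1, h2T'⟩,
        Imat_le_Iinf hT hy' (N + 1) (⟨2 * T - 2, h2T⟩ : Fin (2 * T)) ⟨2 * T - 1, h2T'⟩]
    have : Iinf T y ⟨2 * T - 2, h2T⟩ ⟨2 * T - 1, h2T'⟩ ≤ Iinf T y' ⟨2 * T - 2, h2T⟩ ⟨2 * T - 1, h2T'⟩ - hexCriticalFugacity * (y' - y) :=
      ciSup_le fun N => by linarith [key N]
    linarith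
  · -- bounded partial sums at the entry `(0,0)`
    obtain ⟨B, hB⟩ := exists_partialSum_pow_Iinf_le hT hy
    exact ⟨B, fun n => hB n _ _⟩

end Pole

/-! ### §7 ★★★ The first-order bound of the horizontal-bridge series and the unconditional (P) -/

section Final

variable {T : ℕ}

/-- `#renewal indices ≤ |l| − 2`, hence `npieces l ≤ |l| − 1`. [cite: DuminilCopinHammond2013, §2.2] -/
theorem npieces_le_length (l : List HV) (h2 : 2 ≤ l.length) : 1 ≤ npieces l ∧ npieces l ≤ l.length - 1 := by
  refine ⟨by rw [npieces]; omega, ?_⟩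
  rw [npieces]
  have hsub : renIdxs l ⊆ Finset.Ioo 0 (l.length - 1) := by
    intro i hi
    rw [renIdxs, mem_filter] at hi
    rw [Finset.mem_Ioo]
    exact ⟨hi.2.1, by have := hi.2.2.1; omega⟩
  have := (card_le_card hsub).trans_eq (Nat.card_Ioo _ _)
  omega

/-- `D_N(a,b) ≤ Σ_{k<N} D^{(k+1)}_N(a,b)`: every bridge with `≤ N+1` vertices has between `1` and `N` pieces.
[cite: DuminilCopinHammond2013, §2.2] -/
theorem Dab_le_sum_Dk {N : ℕ} {y : ℝ} (hy : 0 ≤ y) (a b : ℤ) : Dab T N a b y ≤ ∑ k ∈ range N, Dk T N (k + 1) a b y := by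
  classical
  have hdisj : Set.PairwiseDisjoint (range N : Set ℕ) fun k => HBk T N (k + 1) a b := by
    intro i _ j _ hij
    rw [Function.onFun, disjoint_left]
    intro l h1 h2
    rw [HBk, mem_filter] at h1 h2
    exact hij (by have := h1.2.2.1.symm.trans h2.2.2.1; omega)
  rw [Dab]
  calc ∑ l ∈ HBab T N a b, wD T y l ≤ ∑ l ∈ (range N).biUnion fun k => HBk T N (k + 1) a b, wD T y l := by
        refine sum_le_sum_of_subset_of_nonneg (fun l hl => ?_) fun _ _ _ => wD_nonneg T hy _
        rw [HBab, mem_filter] at hl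
        have hlen := (mem_hBridgesN_iff.1 hl.1).2.2.1
        obtain ⟨h1, h2⟩ := npieces_le_length l hl.2.1
        rw [mem_biUnion]
        refine ⟨npieces l - 1, mem_range.2 (by omega), ?_⟩
        rw [HBk, mem_filter]
        exact ⟨hl.1, hl.2.1, by omega, hl.2.2⟩
    _ = ∑ k ∈ range N, Dk T N (k + 1) a b y := by rw [sum_biUnion hdisj]; rfl

/-- The singletons of `hBridgesN` are bounded in number by `#stripChains T 0`, and every list of `hBridgesN` weighs at most
`x_c · y · wD` (`y ≥ 1`). [cite: BeatonBousquetMelouDeGierDuminilCopinGuttmann2014, §4] -/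
theorem hBridgeSumN_le_aux {N : ℕ} {y : ℝ} (hy1 : 1 ≤ y) :
    hBridgeSumN T N y ≤ hexCriticalFugacity * y * ((stripChains T 0).card + ∑ ab : Fin (2 * T) × Fin (2 * T),
      Dab T N (ab.1 : ℕ) (ab.2 : ℕ) y) := by
  classical
  have hx := hexCriticalFugacity_pos_lt_one
  have hy0 : 0 ≤ y := by linarith
  -- termwise: x_c^{|l|} y^{top l} ≤ x_c y wD(l)
  have hterm : ∀ l ∈ hBridgesN T N, hexCriticalFugacity ^ l.length * y ^ topCnt T l ≤ hexCriticalFugacity * y * wD T y l := by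
    intro l hl
    obtain ⟨-, -, -, -, -, ⟨hne, -⟩⟩ := mem_hBridgesN_iff.1 hl
    obtain ⟨v, t, rfl⟩ := List.exists_cons_of_ne_nil hne
    rw [wD, topCnt_cons, List.length_cons, List.tail_cons, Nat.add_sub_cancel, pow_succ, pow_add]
    have h1 : y ^ (if lev v = 2 * (T : ℤ) - 1 then 1 else 0) ≤ y := by split_ifs <;> simp [hy1]
    have h2 : 0 ≤ hexCriticalFugacity ^ t.length := pow_nonneg hx.1.le _
    have h3 : 0 ≤ y ^ topCnt T t := pow_nonneg hy0 _
    calc hexCriticalFugacity ^ t.length * hexCriticalFugacity * (y ^ (if lev v = 2 * (T : ℤ) - 1 then 1 else 0) * y ^ topCnt T t)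
        ≤ hexCriticalFugacity ^ t.length * hexCriticalFugacity * (y * y ^ topCnt T t) := by
          exact mul_le_mul_of_nonneg_left (mul_le_mul_of_nonneg_right h1 h3) (mul_nonneg h2 hx.1.le)
      _ = hexCriticalFugacity * y * (hexCriticalFugacity ^ t.length * y ^ topCnt T t) := by ring
  -- split into singletons and longer lists
  set S1 := (hBridgesN T N).filter fun l => l.length < 2 with hS1
  set S2 := (hBridgesN T N).filter fun l => 2 ≤ l.length with hS2
  have hsplit : hBridgeSumN T N y = ∑ l ∈ S1, hexCriticalFugacity ^ l.length * y ^ topCnt T l +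
      ∑ l ∈ S2, hexCriticalFugacity ^ l.length * y ^ topCnt T l := by
    rw [hBridgeSumN, hS1, hS2, ← sum_filter_add_sum_filter_not (hBridgesN T N) (fun l => l.length < 2)]
    congr 1
    exact sum_congr (filter_congr fun l _ => not_lt) fun _ _ => rfl
  -- singletons
  have h1 : ∑ l ∈ S1, hexCriticalFugacity ^ l.length * y ^ topCnt T l ≤ hexCriticalFugacity * y * (stripChains T 0).card := by
    calc ∑ l ∈ S1, hexCriticalFugacity ^ l.length * y ^ topCnt T l ≤ ∑ l ∈ S1, hexCriticalFugacity * y * 1 := by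
          refine sum_le_sum fun l hl => ?_
          rw [hS1, mem_filter] at hl
          refine (hterm l hl.1).trans (mul_le_mul_of_nonneg_left ?_ (mul_nonneg hx.1.le hy0))
          obtain ⟨-, -, -, -, -, ⟨hne, -⟩⟩ := mem_hBridgesN_iff.1 hl.1
          obtain ⟨v, t, rfl⟩ := List.exists_cons_of_ne_nil hne
          have : t = [] := by simpa using (by simpa using hl.2 : t.length < 1)
          subst this
          simp [wD, topCnt]
      _ = hexCriticalFugacity * y * S1.card := by rw [sum_const, nsmul_eq_mul]; ring
      _ ≤ hexCriticalFugacity * y * (stripChains T 0).card := by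
          refine mul_le_mul_of_nonneg_left ?_ (mul_nonneg hx.1.le hy0)
          exact_mod_cast card_le_card fun l hl => by
            rw [hS1, mem_filter, mem_hBridgesN_iff] at hl
            obtain ⟨⟨hc, hnd, -, hh, hin, ⟨hne, -⟩⟩, hlt⟩ := hl
            exact mem_stripChains_iff.2 ⟨hc, hnd, by have := List.length_pos_of_ne_nil hne; omega, hh, hin⟩
  -- longer lists: into the level classes
  have h2 : ∑ l ∈ S2, hexCriticalFugacity ^ l.length * y ^ topCnt T l ≤
      hexCriticalFugacity * y * ∑ ab : Fin (2 * T) × Fin (2 * T), Dab T N (ab.1 : ℕ) (ab.2 : ℕ) y := by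
    have hdisj : Set.PairwiseDisjoint (Set.univ : Set (Fin (2 * T) × Fin (2 * T)))
        fun ab => HBab T N (ab.1 : ℕ) (ab.2 : ℕ) := by
      intro ab _ ab' _ hne
      rw [Function.onFun, disjoint_left]
      intro l hl hl'
      rw [HBab, mem_filter] at hl hl'
      apply hne
      refine Prod.ext (Fin.ext ?_) (Fin.ext ?_)
      · have := hl.2.2.1.symm.trans hl'.2.2.1; exact_mod_cast this
      · have := hl.2.2.2.symm.trans hl'.2.2.2; exact_mod_cast this
    calc ∑ l ∈ S2, hexCriticalFugacity ^ l.length * y ^ topCnt T l ≤ ∑ l ∈ S2, hexCriticalFugacity * y * wD T y l :=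
          sum_le_sum fun l hl => hterm l (by rw [hS2, mem_filter] at hl; exact hl.1)
      _ = hexCriticalFugacity * y * ∑ l ∈ S2, wD T y l := by rw [mul_sum]
      _ ≤ hexCriticalFugacity * y * ∑ l ∈ (univ : Finset (Fin (2 * T) × Fin (2 * T))).biUnion
            fun ab => HBab T N (ab.1 : ℕ) (ab.2 : ℕ), wD T y l := by
          refine mul_le_mul_of_nonneg_left ?_ (mul_nonneg hx.1.le hy0)
          refine sum_le_sum_of_subset_of_nonneg (fun l hl => ?_) fun _ _ _ => wD_nonneg T hy0 _
          rw [hS2, mem_filter] at hl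
          obtain ⟨hl, h2⟩ := hl
          have hne : l ≠ [] := List.ne_nil_of_length_pos (by omega)
          obtain ⟨b1, b2, b3, b4⟩ := hdLev_ltLev_bounds (mem_hBridgesN_iff.1 hl).2.2.2.2.1 hne
          rw [mem_biUnion]
          refine ⟨(⟨(hdLev l).toNat, by omega⟩, ⟨(ltLev l).toNat, by omega⟩), mem_univ _, ?_⟩
          rw [HBab, mem_filter]
          exact ⟨hl, h2, by simp; omega, by simp; omega⟩
      _ = _ := by rw [sum_biUnion (fun ab _ ab' _ h => hdisj (Set.mem_univ ab) (Set.mem_univ ab') h)]; rfl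
  rw [hsplit, mul_add]
  linarith

/-- ★★★ **First-order bound of the truncated horizontal-bridge series**: for `T ≥ 1` there is `C` with
`D_N(y) = hBridgeSumN T N y ≤ C/(y_T − y)` for all `N` and all `y ∈ [1, y_T)` — the binder of
`stripByLim_mul_sub_le_of_hBridge_bound`, now PROVED (renewal structure + `nonnegMat_exists_partialSum_pow_apply_le_div`).
[cite: DuminilCopinHammond2013, §2.2; Seneta1973, Theorem 6.1; lane (MATHS-NOTE-k1-renewal [D])] -/
theorem hBridgeSumN_le_div (hT : 1 ≤ T) :
    ∃ C : ℝ, ∀ N : ℕ, ∀ y : ℝ, 1 ≤ y → y < stripYT T → hBridgeSumN T N y ≤ C / (stripYT T - y) := by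
  classical
  have hx := hexCriticalFugacity_pos_lt_one
  obtain ⟨C, hC⟩ := exists_partialSum_pow_Iinf_le_div hT
  have hyT := one_lt_stripYT hT
  set K : ℝ := ((stripChains T 0).card : ℝ) with hK
  set F : ℝ := (Fintype.card (Fin (2 * T) × Fin (2 * T)) : ℝ) with hF
  -- `C ≥ 0`: test at `y = 1`, `n = 0`
  have hC0 : 0 ≤ C := by
    have h := hC 1 ⟨le_rfl, hyT⟩ 0 ⟨0, by omega⟩ ⟨0, by omega⟩
    simp only [sum_range_zero, Matrix.zero_apply] at h
    have : 0 < stripYT T - 1 := by linarith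
    by_contra hneg
    push Not at hneg
    have : C / (stripYT T - 1) < 0 := div_neg_of_neg_of_pos hneg this
    linarith
  refine ⟨stripYT T * stripYT T * K + stripYT T * F * C, fun N y hy1 hyT' => ?_⟩
  have hy0 : 0 ≤ y := by linarith
  have hmem : y ∈ Set.Ico (1 : ℝ) (stripYT T) := ⟨hy1, hyT'⟩
  have hpos : 0 < stripYT T - y := by linarith
  -- each level class is bounded by the pole bound
  have hDab : ∀ ab : Fin (2 * T) × Fin (2 * T), Dab T N (ab.1 : ℕ) (ab.2 : ℕ) y ≤ C / (stripYT T - y) := by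
    intro ab
    calc Dab T N (ab.1 : ℕ) (ab.2 : ℕ) y ≤ ∑ k ∈ range N, Dk T N (k + 1) (ab.1 : ℕ) (ab.2 : ℕ) y := Dab_le_sum_Dk hy0 _ _
      _ ≤ ∑ k ∈ range N, (Iinf T y ^ (k + 1)) ab.1 ab.2 := by
          refine sum_le_sum fun k _ => ?_
          calc Dk T N (k + 1) (ab.1 : ℕ) (ab.2 : ℕ) y = Dmat T N (k + 1) y ab.1 ab.2 := rfl
            _ ≤ (Imat T N y ^ (k + 1)) ab.1 ab.2 := Dmat_le_pow hy0 (k + 1) (by omega) _ _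
            _ ≤ (Iinf T y ^ (k + 1)) ab.1 ab.2 := nonnegMat_pow_apply_mono
                (fun a b => (Imat_Dmat_nonneg (N := N) (k := 1) hy0 a b).1) (fun a b => Imat_le_Iinf hT hmem N a b) _ _ _
      _ ≤ ∑ k ∈ range (N + 1), (Iinf T y ^ k) ab.1 ab.2 := by
          rw [sum_range_succ']
          have : 0 ≤ (Iinf T y ^ 0) ab.1 ab.2 := by rw [pow_zero, Matrix.one_apply]; split_ifs <;> norm_num
          linarith
      _ = (∑ k ∈ range (N + 1), Iinf T y ^ k) ab.1 ab.2 := by rw [Matrix.sum_apply]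
      _ ≤ C / (stripYT T - y) := hC y hmem (N + 1) _ _
  have hsum : ∑ ab : Fin (2 * T) × Fin (2 * T), Dab T N (ab.1 : ℕ) (ab.2 : ℕ) y ≤ F * (C / (stripYT T - y)) := by
    calc ∑ ab : Fin (2 * T) × Fin (2 * T), Dab T N (ab.1 : ℕ) (ab.2 : ℕ) y ≤ ∑ _ab : Fin (2 * T) × Fin (2 * T), C / (stripYT T - y) :=
          sum_le_sum fun ab _ => hDab ab
      _ = F * (C / (stripYT T - y)) := by rw [sum_const, nsmul_eq_mul, hF, Finset.card_univ]
  have haux := hBridgeSumN_le_aux (T := T) (N := N) hy1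
  -- assemble: x_c y (K + F C/(y_T − y)) ≤ (y_T² K + y_T F C)/(y_T − y)
  have hxy : hexCriticalFugacity * y ≤ stripYT T := by nlinarith [hx.1, hx.2]
  have hK0 : 0 ≤ K := by positivity
  have hF0 : 0 ≤ F := by positivity
  rw [le_div_iff₀ hpos]
  have hq : 0 ≤ C / (stripYT T - y) := div_nonneg hC0 hpos.le
  calc hBridgeSumN T N y * (stripYT T - y)
      ≤ hexCriticalFugacity * y * (K + F * (C / (stripYT T - y))) * (stripYT T - y) := by
        refine mul_le_mul_of_nonneg_right (haux.trans ?_) hpos.le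
        exact mul_le_mul_of_nonneg_left (by linarith) (mul_nonneg hx.1.le hy0)
    _ ≤ stripYT T * (K + F * (C / (stripYT T - y))) * (stripYT T - y) := by
        refine mul_le_mul_of_nonneg_right (mul_le_mul_of_nonneg_right hxy ?_) hpos.le
        exact add_nonneg hK0 (mul_nonneg hF0 hq)
    _ = stripYT T * K * (stripYT T - y) + stripYT T * F * C := by field_simp
    _ ≤ stripYT T * stripYT T * K + stripYT T * F * C := by
        have : stripYT T - y ≤ stripYT T := by linarith
        nlinarith [mul_nonneg (by linarith : (0 : ℝ) ≤ stripYT T) hK0]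

/-- ★★★ **(P) — the first-order upper law of the β-series at criticality, unconditionally**: for every width `T ≥ 2` there is
`A` with `B_T(x_c; y) · (y_T − y) ≤ A` for all `1 ≤ y < y_T` (`stripByLim_mul_sub_le_of_hBridge_bound` fed with
`hBridgeSumN_le_div`).  Equivalently (THRESHOLD-LAW / LINLAW, k = 1): `β_{T,m}(x_c) y_T^m` is bounded in `m` and
`B_{T,L}(x_c; y_T) ≍ L`.  Own result of the lane (honeycomb strip, DCS parafermionic setting); nothing printed claims it.
[cite: BeatonBousquetMelouDeGierDuminilCopinGuttmann2014, §4 and Corollary 8 (setting); DuminilCopinHammond2013, §2.2 (renewal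
structure); Seneta1973, Theorem 6.1 (R-positivity heuristics); lane (MATHS-NOTE-k1-renewal)] -/
theorem stripByLim_mul_sub_le (hT : 2 ≤ T) :
    ∃ A : ℝ, ∀ y : ℝ, 1 ≤ y → y < stripYT T → stripByLim T y * (stripYT T - y) ≤ A :=
  stripByLim_mul_sub_le_of_hBridge_bound hT (hBridgeSumN_le_div (by omega))

end Final


/-! ### §8 Width one, and (P) for every width `T ≥ 1` -/

section AllWidths

variable {T : ℕ}

/-- **(P) at width one, explicitly**: `B_1(x_c; y) · (y_1 − y) ≤ 2 y_1` for `0 ≤ y < y_1` (the width-one β-class is the geometric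
series `2 Σ_k (x_c² y)^k` and `x_c² y_1 = 1`). [cite: BeatonBousquetMelouDeGierDuminilCopinGuttmann2014, §3.2 (proof of Proposition 5: the zig-zag walks) and Corollary 8; lane: `stripGFy_beta_one_le`, `stripYT_one`] -/
theorem stripByLim_one_mul_sub_le {y : ℝ} (hy : 0 ≤ y) (hyT : y < stripYT 1) :
    stripByLim 1 y * (stripYT 1 - y) ≤ 2 * stripYT 1 := by
  have hx := hexCriticalFugacity_pos_lt_one
  have h1 := hexCriticalFugacity_sq_mul_stripYT_one
  have hx2 : 0 < hexCriticalFugacity ^ 2 := pow_pos hx.1 2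
  have hq : hexCriticalFugacity ^ 2 * y < 1 := by nlinarith
  have hsub : 1 - hexCriticalFugacity ^ 2 * y = hexCriticalFugacity ^ 2 * (stripYT 1 - y) := by linear_combination (-1 : ℝ) * h1
  have hpos : 0 < stripYT 1 - y := by linarith
  have hB : stripByLim 1 y ≤ 2 * ((hexCriticalFugacity ^ 2 * y) / (1 - hexCriticalFugacity ^ 2 * y)) :=
    ciSup_le fun L => stripGFy_beta_one_le hy hq L
  calc stripByLim 1 y * (stripYT 1 - y) ≤ 2 * ((hexCriticalFugacity ^ 2 * y) / (1 - hexCriticalFugacity ^ 2 * y)) * (stripYT 1 - y) :=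
        mul_le_mul_of_nonneg_right hB hpos.le
    _ = 2 * y := by
        have hx0 : hexCriticalFugacity ≠ 0 := hx.1.ne'
        have hp0 : stripYT 1 - y ≠ 0 := hpos.ne'
        rw [hsub]
        field_simp
    _ ≤ 2 * stripYT 1 := by linarith

/-- ★★★ **(P) for every width `T ≥ 1`**: `∃ A, ∀ y ∈ [1, y_T), B_T(x_c; y) · (y_T − y) ≤ A` — width one by the explicit series,
`T ≥ 2` by `stripByLim_mul_sub_le`. [cite: BeatonBousquetMelouDeGierDuminilCopinGuttmann2014, §4 and Corollary 8 (setting);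
DuminilCopinHammond2013, §2.2; lane (MATHS-NOTE-k1-renewal)] -/
theorem stripByLim_mul_sub_le_of_one_le (hT : 1 ≤ T) :
    ∃ A : ℝ, ∀ y : ℝ, 1 ≤ y → y < stripYT T → stripByLim T y * (stripYT T - y) ≤ A := by
  rcases Nat.lt_or_ge T 2 with h | h
  · obtain rfl : T = 1 := by omega
    exact ⟨2 * stripYT 1, fun y hy1 hyT => stripByLim_one_mul_sub_le (by linarith) hyT⟩
  · exact stripByLim_mul_sub_le h

end AllWidths


/-! ### §9 ★★★ The linear upper law in the boxes: `B_{T,L}(x_c; y_T) ≤ C · (L + 1)` -/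

section LinearUpper

variable {T : ℕ}

/-- Raising the fugacity from `y` to `y' ≥ y > 0` costs at most the factor `(y'/y)^{|V(S_{T,L})|}` on the β-class of the box.
[cite: BeatonBousquetMelouDeGierDuminilCopinGuttmann2014, §3.2 (B_{T,L}(x; y) is a polynomial in y of degree ≤ |V|)] -/
theorem stripGFy_beta_le_pow_mul (hT : 1 ≤ T) (L : ℕ) {y y' : ℝ} (hy : 0 < y) (hyy : y ≤ y') :
    stripGFy T L (IsBetaDart T) y' ≤ (y' / y) ^ (stripV T L).card * stripGFy T L (IsBetaDart T) y := by
  have hx := hexCriticalFugacity_pos_lt_one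
  have hr : 1 ≤ y' / y := by rw [le_div_iff₀ hy, one_mul]; exact hyy
  rw [stripGFy_beta_eq_sum_bridgeLists hT, stripGFy_beta_eq_sum_bridgeLists hT, mul_sum]
  refine sum_le_sum fun l hl => ?_
  set k := (l.filter fun v => lev v = 2 * (T : ℤ) - 1).length with hk
  have hkle : k ≤ (stripV T L).card := (List.length_filter_le _ _).trans (length_le_card_stripV hT hl)
  have e : y' ^ k = (y' / y) ^ k * y ^ k := by rw [← mul_pow, div_mul_cancel₀ _ hy.ne']
  rw [e]
  have h1 : (y' / y) ^ k ≤ (y' / y) ^ (stripV T L).card := pow_le_pow_right₀ hr hkle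
  have h2 : 0 ≤ hexCriticalFugacity ^ l.length * y ^ k := mul_nonneg (pow_nonneg hx.1.le _) (pow_nonneg hy.le _)
  calc hexCriticalFugacity ^ l.length * ((y' / y) ^ k * y ^ k) = (y' / y) ^ k * (hexCriticalFugacity ^ l.length * y ^ k) := by ring
    _ ≤ (y' / y) ^ (stripV T L).card * (hexCriticalFugacity ^ l.length * y ^ k) := mul_le_mul_of_nonneg_right h1 h2

/-- `(1 + 1/L)^{aL + b} ≤ exp(a + b)` for `L ≥ 1` (plumbing for the transfer at `y = y_T L/(L+1)`).
[cite: DuminilCopinHammond2013, §2.2 (bridges of the strip); lane plumbing] -/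
theorem one_add_inv_pow_le_exp (a b L : ℕ) (hL : 1 ≤ L) :
    ((L + 1 : ℝ) / L) ^ (a * L + b) ≤ Real.exp (a + b) := by
  have hL0 : (0 : ℝ) < L := by exact_mod_cast hL
  have h1 : ((L + 1 : ℝ) / L) = 1 + 1 / L := by field_simp
  have h2 : ((L + 1 : ℝ) / L) ≤ Real.exp (1 / L) := by rw [h1, add_comm]; exact Real.add_one_le_exp _
  have h3 : 0 ≤ ((L + 1 : ℝ) / L) := by positivity
  calc ((L + 1 : ℝ) / L) ^ (a * L + b) ≤ (Real.exp (1 / L)) ^ (a * L + b) := pow_le_pow_left₀ h3 h2 _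
    _ = Real.exp ((a * L + b : ℕ) * (1 / L)) := by rw [← Real.exp_nat_mul]
    _ ≤ Real.exp (a + b) := by
        refine Real.exp_le_exp.2 ?_
        have hb : (b : ℝ) * (1 / L) ≤ b := by
          rw [mul_one_div]; exact div_le_self (Nat.cast_nonneg b) (by exact_mod_cast hL)
        have : ((a * L + b : ℕ) : ℝ) * (1 / L) = a + b * (1 / L) := by push_cast; field_simp
        rw [this]; linarith

/-- ★★★ **The linear upper law of the β-class at its own threshold, for every width `T ≥ 1`**: there is `C = C(T)` with
`B_{T,L}(x_c; y_T) ≤ C · (L + 1)` for all `L` — from (P) by the transfer `y = y_T · L/(L+1)`: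
`B_{T,L}(y_T) ≤ (y_T/y)^{|V(S_{T,L})|} B_{T,L}(y) ≤ e^{O(T)} · B_T(y) ≤ e^{O(T)} A (L+1)/y_T`.  Together with the lane's lower law this is
`B_{T,L}(x_c; y_T) ≍ L` (k = 1). Own result of the lane. [cite: BeatonBousquetMelouDeGierDuminilCopinGuttmann2014, §3.2 and Corollary 8
(setting: B_T(x_c; ·) has radius y_T); DuminilCopinHammond2013, §2.2; lane (MATHS-NOTE-k1-renewal)] -/
theorem stripGFy_beta_stripYT_le_linear (hT : 1 ≤ T) :
    ∃ C : ℝ, ∀ L : ℕ, stripGFy T L (IsBetaDart T) (stripYT T) ≤ C * ((L : ℝ) + 1) := by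
  have hx := hexCriticalFugacity_pos_lt_one
  have hyT := one_lt_stripYT hT
  have hyT0 : 0 < stripYT T := by linarith
  obtain ⟨A, hA⟩ := stripByLim_mul_sub_le_of_one_le hT
  -- `A ≥ 0` (test at `y = 1`)
  have hA0 : 0 ≤ A := by
    have hb : BddAbove (Set.range fun L : ℕ => stripGFy T L (IsBetaDart T) 1) :=
      (bddAbove_stripGFy_beta_iff_lt_stripYT hT zero_le_one).2 hyT
    have h0 : 0 ≤ stripByLim T 1 := (stripGFy_nonneg' T 0 (IsBetaDart T) zero_le_one).trans (le_ciSup hb 0)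
    have := hA 1 le_rfl hyT
    nlinarith
  -- the threshold `L₀` beyond which `y_T L/(L+1) ≥ 1`
  obtain ⟨L₀, hL₀⟩ : ∃ L₀ : ℕ, 1 ≤ L₀ ∧ (1 : ℝ) ≤ L₀ * (stripYT T - 1) := by
    obtain ⟨n, hn⟩ := exists_nat_ge (1 / (stripYT T - 1))
    refine ⟨n + 1, by omega, ?_⟩
    have hpos : 0 < stripYT T - 1 := by linarith
    rw [div_le_iff₀ hpos] at hn
    push_cast; nlinarith
  set a := 4 * (T + 1) with ha
  set b := 2 * (T + 1) ^ 2 with hb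
  set E := Real.exp (a + b) with hE
  have hE0 : 0 ≤ E := (Real.exp_pos _).le
  -- the bound for `L ≥ L₀`
  have main : ∀ L : ℕ, L₀ ≤ L → stripGFy T L (IsBetaDart T) (stripYT T) ≤ E * A / stripYT T * ((L : ℝ) + 1) := by
    intro L hL
    have hL1 : (1 : ℝ) ≤ L := by exact_mod_cast hL₀.1.trans hL
    have hLpos : (0 : ℝ) < L := by linarith
    set y := stripYT T * L / (L + 1) with hy
    have hL1' : (0 : ℝ) < L + 1 := by linarith
    have hy1 : 1 ≤ y := by
      rw [hy, le_div_iff₀ hL1']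
      have hcast : (L₀ : ℝ) ≤ L := by exact_mod_cast hL
      have : (1 : ℝ) ≤ L * (stripYT T - 1) := hL₀.2.trans (mul_le_mul_of_nonneg_right hcast (by linarith))
      nlinarith
    have hy0 : 0 < y := by linarith
    have hylt : y < stripYT T := by rw [hy, div_lt_iff₀ hL1']; nlinarith
    have hsub : stripYT T - y = stripYT T / (L + 1) := by rw [hy]; field_simp; ring
    have hratio : stripYT T / y = (L + 1) / L := by rw [hy]; field_simp
    -- B_{T,L}(y) ≤ B_T(y) ≤ A/(y_T − y) = A (L+1)/y_T
    have hb : BddAbove (Set.range fun L : ℕ => stripGFy T L (IsBetaDart T) y) :=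
      (bddAbove_stripGFy_beta_iff_lt_stripYT hT hy0.le).2 hylt
    have hB1 : stripGFy T L (IsBetaDart T) y ≤ stripByLim T y := le_ciSup hb L
    have hB2 : stripByLim T y ≤ A * (L + 1) / stripYT T := by
      have := hA y hy1 hylt
      rw [hsub] at this
      rw [le_div_iff₀ hyT0]
      have e : stripByLim T y * (stripYT T / (L + 1)) * (L + 1) = stripByLim T y * stripYT T := by field_simp
      nlinarith [mul_le_mul_of_nonneg_right this hL1'.le]
    -- the transfer factor
    have hpow : (stripYT T / y) ^ (stripV T L).card ≤ E := by
      rw [hratio]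
      have hr1 : (1 : ℝ) ≤ (L + 1) / L := by rw [le_div_iff₀ hLpos]; linarith
      calc (((L : ℝ) + 1) / L) ^ (stripV T L).card ≤ (((L : ℝ) + 1) / L) ^ (a * L + b) :=
            pow_le_pow_right₀ hr1 (LinLow.card_stripV_le_affine T L)
        _ ≤ Real.exp (a + b) := one_add_inv_pow_le_exp a b L (by exact_mod_cast hL₀.1.trans hL)
    have hG0 : 0 ≤ stripGFy T L (IsBetaDart T) y := stripGFy_nonneg' T L _ hy0.le
    calc stripGFy T L (IsBetaDart T) (stripYT T) ≤ (stripYT T / y) ^ (stripV T L).card * stripGFy T L (IsBetaDart T) y :=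
          stripGFy_beta_le_pow_mul hT L hy0 hylt.le
      _ ≤ E * (A * (L + 1) / stripYT T) := mul_le_mul hpow (hB1.trans hB2) hG0 hE0
      _ = E * A / stripYT T * ((L : ℝ) + 1) := by field_simp
  refine ⟨E * A / stripYT T * ((L₀ : ℝ) + 1), fun L => ?_⟩
  have hK0 : 0 ≤ E * A / stripYT T := div_nonneg (mul_nonneg hE0 hA0) hyT0.le
  rcases le_or_gt L₀ L with hL | hL
  · calc stripGFy T L (IsBetaDart T) (stripYT T) ≤ E * A / stripYT T * ((L : ℝ) + 1) := main L hL
      _ ≤ E * A / stripYT T * ((L₀ : ℝ) + 1) * ((L : ℝ) + 1) := by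
          have : (1 : ℝ) ≤ (L₀ : ℝ) + 1 := by have := hL₀.1; norm_cast; omega
          nlinarith [mul_nonneg hK0 (by positivity : (0 : ℝ) ≤ (L : ℝ) + 1)]
  · calc stripGFy T L (IsBetaDart T) (stripYT T) ≤ stripGFy T L₀ (IsBetaDart T) (stripYT T) :=
          stripGFy_beta_mono_L hL.le hyT0.le
      _ ≤ E * A / stripYT T * ((L₀ : ℝ) + 1) := main L₀ le_rfl
      _ ≤ E * A / stripYT T * ((L₀ : ℝ) + 1) * ((L : ℝ) + 1) := by
          have h1 : (1 : ℝ) ≤ (L : ℝ) + 1 := by have := (Nat.cast_nonneg L : (0:ℝ) ≤ L); linarith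
          nlinarith [mul_nonneg hK0 (by positivity : (0 : ℝ) ≤ (L₀ : ℝ) + 1)]

end LinearUpper


/-! ### §10 ★★★ The Cesàro coefficient law: `Σ_{m ≤ M} β_{T,m}(x_c) · y_T^m ≤ C · (M + 1)` -/

section Cesaro

variable {T : ℕ}

/-- ★★★ **Cesàro (first-order) law of the surface-contact coefficients at the threshold, every width `T ≥ 1`**: with
`β_{T,m} = stripBcoeff T m` (the `y^m`-coefficient of `B_T(x_c; ·)`), `Σ_{m ≤ M} β_{T,m} y_T^m ≤ C · (M + 1)` for all `M` — from (P) at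
`y = y_T · M/(M+1)` (`(y_T/y)^m ≤ (1 + 1/M)^M ≤ e` for `m ≤ M`) and `Σ_m β_{T,m} y^m = B_T(x_c; y)` inside the radius
(`hasSum_stripBcoeff_of_lt_stripYT`).  Pointwise boundedness of `β_{T,m} y_T^m` is NOT claimed.  Own result of the lane.
[cite: BeatonBousquetMelouDeGierDuminilCopinGuttmann2014, §3.2 and Corollary 8 (B_T(x_c; y) = Σ_m β_{T,m} y^m has radius y_T);
DuminilCopinHammond2013, §2.2; lane (MATHS-NOTE-k1-renewal)] -/
theorem partialSum_stripBcoeff_stripYT_le_linear (hT : 1 ≤ T) :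
    ∃ C : ℝ, ∀ M : ℕ, ∑ m ∈ range (M + 1), stripBcoeff T m * stripYT T ^ m ≤ C * ((M : ℝ) + 1) := by
  have hyT := one_lt_stripYT hT
  have hyT0 : 0 < stripYT T := by linarith
  obtain ⟨A, hA⟩ := stripByLim_mul_sub_le_of_one_le hT
  have hA0 : 0 ≤ A := by
    have hb : BddAbove (Set.range fun L : ℕ => stripGFy T L (IsBetaDart T) 1) :=
      (bddAbove_stripGFy_beta_iff_lt_stripYT hT zero_le_one).2 hyT
    have h0 : 0 ≤ stripByLim T 1 := (stripGFy_nonneg' T 0 (IsBetaDart T) zero_le_one).trans (le_ciSup hb 0)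
    have := hA 1 le_rfl hyT
    nlinarith
  obtain ⟨M₀, hM₀⟩ : ∃ M₀ : ℕ, 1 ≤ M₀ ∧ (1 : ℝ) ≤ M₀ * (stripYT T - 1) := by
    obtain ⟨n, hn⟩ := exists_nat_ge (1 / (stripYT T - 1))
    refine ⟨n + 1, by omega, ?_⟩
    have hpos : 0 < stripYT T - 1 := by linarith
    rw [div_le_iff₀ hpos] at hn
    push_cast; nlinarith
  have hterm0 : ∀ m, 0 ≤ stripBcoeff T m * stripYT T ^ m := fun m => mul_nonneg (stripBcoeff_nonneg hT m) (pow_nonneg hyT0.le m)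
  set E := Real.exp 1 with hE
  have hE0 : 0 ≤ E := (Real.exp_pos _).le
  -- the bound for `M ≥ M₀`
  have main : ∀ M : ℕ, M₀ ≤ M → ∑ m ∈ range (M + 1), stripBcoeff T m * stripYT T ^ m ≤ E * A / stripYT T * ((M : ℝ) + 1) := by
    intro M hM
    have hM1 : (1 : ℝ) ≤ M := by exact_mod_cast hM₀.1.trans hM
    have hMpos : (0 : ℝ) < M := by linarith
    have hM1' : (0 : ℝ) < M + 1 := by linarith
    set y := stripYT T * M / (M + 1) with hy
    have hy1 : 1 ≤ y := by
      rw [hy, le_div_iff₀ hM1']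
      have hcast : (M₀ : ℝ) ≤ M := by exact_mod_cast hM
      have : (1 : ℝ) ≤ M * (stripYT T - 1) := hM₀.2.trans (mul_le_mul_of_nonneg_right hcast (by linarith))
      nlinarith
    have hy0 : 0 < y := by linarith
    have hylt : y < stripYT T := by rw [hy, div_lt_iff₀ hM1']; nlinarith
    have hsub : stripYT T - y = stripYT T / (M + 1) := by rw [hy]; field_simp; ring
    have hratio : stripYT T / y = (M + 1) / M := by rw [hy]; field_simp
    -- `B_T(y) ≤ A (M+1)/y_T`
    have hB : stripByLim T y ≤ A * (M + 1) / stripYT T := by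
      have := hA y hy1 hylt
      rw [hsub] at this
      rw [le_div_iff₀ hyT0]
      have e : stripByLim T y * (stripYT T / (M + 1)) * (M + 1) = stripByLim T y * stripYT T := by field_simp
      nlinarith [mul_le_mul_of_nonneg_right this hM1'.le]
    -- partial sums of the series at `y` are below `B_T(y)`
    have hps : ∑ m ∈ range (M + 1), stripBcoeff T m * y ^ m ≤ stripByLim T y :=
      sum_le_hasSum (range (M + 1)) (fun m _ => mul_nonneg (stripBcoeff_nonneg hT m) (pow_nonneg hy0.le m))
        (hasSum_stripBcoeff_of_lt_stripYT hT hy0.le hylt)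
    -- the transfer factor `(y_T/y)^m ≤ e` for `m ≤ M`
    have hpow : ∀ m ∈ range (M + 1), stripYT T ^ m ≤ E * y ^ m := by
      intro m hm
      rw [mem_range] at hm
      have hr1 : (1 : ℝ) ≤ (M + 1) / M := by rw [le_div_iff₀ hMpos]; linarith
      have e1 : stripYT T ^ m = (stripYT T / y) ^ m * y ^ m := by rw [← mul_pow, div_mul_cancel₀ _ hy0.ne']
      rw [e1, hratio]
      refine mul_le_mul_of_nonneg_right ?_ (pow_nonneg hy0.le _)
      calc (((M : ℝ) + 1) / M) ^ m ≤ (((M : ℝ) + 1) / M) ^ (1 * M + 0) := pow_le_pow_right₀ hr1 (by omega)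
        _ ≤ Real.exp ((1 : ℕ) + (0 : ℕ)) := one_add_inv_pow_le_exp 1 0 M (hM₀.1.trans hM)
        _ = E := by norm_num [hE]
    calc ∑ m ∈ range (M + 1), stripBcoeff T m * stripYT T ^ m ≤ ∑ m ∈ range (M + 1), stripBcoeff T m * (E * y ^ m) :=
          sum_le_sum fun m hm => mul_le_mul_of_nonneg_left (hpow m hm) (stripBcoeff_nonneg hT m)
      _ = E * ∑ m ∈ range (M + 1), stripBcoeff T m * y ^ m := by rw [mul_sum]; exact sum_congr rfl fun m _ => by ring
      _ ≤ E * (A * (M + 1) / stripYT T) := mul_le_mul_of_nonneg_left (hps.trans hB) hE0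
      _ = E * A / stripYT T * ((M : ℝ) + 1) := by field_simp
  refine ⟨E * A / stripYT T * ((M₀ : ℝ) + 1), fun M => ?_⟩
  have hK0 : 0 ≤ E * A / stripYT T := div_nonneg (mul_nonneg hE0 hA0) hyT0.le
  rcases le_or_gt M₀ M with hM | hM
  · calc ∑ m ∈ range (M + 1), stripBcoeff T m * stripYT T ^ m ≤ E * A / stripYT T * ((M : ℝ) + 1) := main M hM
      _ ≤ E * A / stripYT T * ((M₀ : ℝ) + 1) * ((M : ℝ) + 1) := by
          have : (1 : ℝ) ≤ (M₀ : ℝ) + 1 := by have := hM₀.1; norm_cast; omega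
          nlinarith [mul_nonneg hK0 (by positivity : (0 : ℝ) ≤ (M : ℝ) + 1)]
  · calc ∑ m ∈ range (M + 1), stripBcoeff T m * stripYT T ^ m ≤ ∑ m ∈ range (M₀ + 1), stripBcoeff T m * stripYT T ^ m :=
          sum_le_sum_of_subset_of_nonneg (range_subset_range.2 (by omega)) fun m _ _ => hterm0 m
      _ ≤ E * A / stripYT T * ((M₀ : ℝ) + 1) := main M₀ le_rfl
      _ ≤ E * A / stripYT T * ((M₀ : ℝ) + 1) * ((M : ℝ) + 1) := by
          have h1 : (1 : ℝ) ≤ (M : ℝ) + 1 := by have := (Nat.cast_nonneg M : (0:ℝ) ≤ M); linarith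
          nlinarith [mul_nonneg hK0 (by positivity : (0 : ℝ) ≤ (M₀ : ℝ) + 1)]

end Cesaro

end HV

end Literature.Probability.RandomPlanarGeometry.SAW

end
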